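import Literature.NumberTheory.LFunctions.DeBruijnPhiSecondDeriv
import Literature.NumberTheory.LFunctions.DeBruijnPhiThetaTails
import Literature.NumberTheory.LFunctions.XiTiltedPotential
import Literature.NumberTheory.LFunctions.XiMoments
import Literature.NumberTheory.LFunctions.XiGaussModeMap
import Literature.NumberTheory.LFunctions.DeBruijnPhiLogDerivEnvelope
import Literature.NumberTheory.LFunctions.DeBruijnPhiDecreasing
import Literature.NumberTheory.LFunctions.DeBruijnNewmanProofs
import Literature.NumberTheory.LFunctions.DeBruijnPhiLogConcaveSqrt
import HarnessLib

/-!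
# Csordas–Norfolk–Varga 1986: `log Φ(√t)` is concave (kernel interval-arithmetic certificate on `(0,1/4]` + envelope) — `DeBruijnPhiLogConcaveSqrt` HOLDS (re-homed proofs)

**Csordas–Norfolk–Varga 1986 — `log Φ(√t)` is concave: the named fact `Literature.NumberTheory.LFunctions.DeBruijnPhiLogConcaveSqrt`
(`DeBruijnPhiLogConcaveSqrt.lean`) HOLDS**: for the Pólya–de Bruijn kernel `Φ = deBruijnPhi`, the function `u ↦ −Φ′(u)/(uΦ(u))` is non-decreasing
on `(0, ∞)` (G. Csordas, T. S. Norfolk, R. S. Varga, *The Riemann hypothesis and the Turán inequalities*, Trans. AMS 296 (1986), the key lemma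
behind the Turán inequalities for `ξ`; = Dimitrov–Lucas 2011, Theorem B) [CsordasNorfolkVarga1986].  The printed proof is a lengthy analysis of
`Φ` near `0`; the in-tree proof (kernel-checked; until now Summits-side only, `Summits/RiemannHypothesis/RiemannHypothesis/Theorems/JensenPolynomialsXiDeltaSqPos.lean`)
splits `(0, ∞) = (0, 1/4] ∪ [1/4, ∞)`: on `[1/4, ∞)` the tree's envelope argument (`re_strictMonoOn_phiNegLogDeriv_div_quarter`, Literature), on
`(0, 1/4]` a KERNEL-EVALUATED RATIONAL INTERVAL-ARITHMETIC CERTIFICATE — exact interval arithmetic (`ivAdd`, `ivMul`, `pevalR`, `taylorShift`,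
`prange`, `expNegIv`, …), truncated series for `Φ` and its derivatives with tail bounds (`qterm`, `tailC`, `cellIv`), the quadratic forms whose
sign is the monotonicity (`formAIv`, `formTIv`, `checkA`, `checkT`, `checkN`), a cell decomposition of `(0, 1/4]` checked by `decide` in the kernel
(no `native_decide`), and the higher derivatives `Φ‴`, `Φ⁗` (`deBruijnPhiDeriv₃/₄`) with their series.  RE-HOMED into `Literature/` by the
Hodge foundations lane (`lit-hodgefound`, seat p20, generation 38): verbatim DECLARATION-LEVEL ports (the declarations needed, in dependency
order) of the 8 Summits modules `Summits/RiemannHypothesis/RiemannHypothesis/Theorems/JensenPolynomials{XiGorttwCoeffSmallTableCheck (10 of its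
declarations: the interval/grid vocabulary), PhiCellArith (38), PhiCellSeries (20), PhiCellForms (16), PhiCells (13), PhiHigherDeriv (12), PhiMonotone (30),
XiDeltaSqPos (1)}.lean`, namespace `Summit.RiemannHypothesis.RiemannHypothesis.Theorems.JensenPolynomials` re-rooted as
`Literature.NumberTheory.LFunctions.DeBruijnPhiCells` (sub-namespace `CoeffTable` kept), followed by the EXACT-name discharge
`Literature.NumberTheory.LFunctions.DeBruijnPhiLogConcaveSqrt_holds`.  The certificate's definitions come with their bodies (computable
rational gadgets); no new named fact (D-0026), no Summits import; built on the tree's Literature layer (`NumberTheory/LFunctions/{XiMoments,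
XiTiltedPotential, XiGaussModeMap, DeBruijnPhiLogDerivEnvelope, DeBruijnPhiDecreasing, DeBruijnNewmanProofs}`) and Mathlib.  The Summits originals
stay in place (transitional duplication).  WHAT THIS IS NOT: nothing about the Riemann hypothesis (log-concavity of `Φ(√t)` is an RH-free
property of the kernel; it yields the Turán inequalities for `ξ`, which RH would also imply).
-/

noncomputable section

/-!
## Part 1 — port of `Summits/RiemannHypothesis/RiemannHypothesis/Theorems/JensenPolynomialsXiGorttwCoeffSmallTableCheck.lean` (10 declarations kept)

# Route `JensenPolynomials` — TABLE crux, part 2: the exact-ℚ interval checker and its soundness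

Kernel packaging of the TABLE crux `XiGorttwCoeffSmallBelow rhoWinMin 10000` , RH-FREE proof-of-data),
part 2. A cell `(d, n)` of the crux reads the `d` consecutive-ratio boxes `ρ_m ∋ γ(m+1)/γ(m)`, `n ≤ m < n + d`.
From them the COMPUTABLE function `checkCell` encloses, in exact rational arithmetic with outward rounding to the
grid `10^{-64}`, the window ratios `w_i` (part 1), `Δ² = (1 − w_2)/2`, the scaled coefficients `S_k` and the scaled
Hermite coordinates `T_j = c_{d,n,j}·Δ^j`, and decides
`Σ_{j=1}^{d} |c_{d,n,j}|·R(d,j) < 1` and `Σ_{j=1}^{d} |c_{d,n,j}|·t_d^j < 1` by the parity split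
`E + O/Δ ≤ E + O/√δ < 1 ⟸ E < 1 ∧ O² < (1−E)²δ` (`δ ≤ Δ²` the lower end of the `Δ²` box), where `R(d,j)`,
`t_d` are any rationals with `rhoHT d j ≤ R(d,j)` and `2/B_d ≤ t_d` (validity predicates `RValid`, `TValid`,
decidable). MAIN RESULT `cellSmall_of_checkCell`: for ANY real `γ` enclosed by the boxes, `checkCell = true` (with
valid tables, `3 ≤ d < 108`) implies the cell inequality of `XiGorttwCoeffSmallBelow rhoWinMin` at `(d, n)`
(`rhoWinMin ≤ rhoHT` below `d = 108`). Interval lemmas follow Moore's inclusion-monotonicity [Moore1979, Ch. 3];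
pattern of the tree's `JensenCoeffBox` (`JensenShiftCertificate.lean`). Nothing here bears on the truth of RH.

(Verbatim declaration-level port — the declarations listed in the Part header count — of the Summits-side module of the
RiemannHypothesis tree's Jensen-polynomial cell; cell / rung / item bookkeeping in the text above is historical.)
-/

section Part1

namespace Literature.NumberTheory.LFunctions.DeBruijnPhiCells.CoeffTable

open Literature.NumberTheory.LFunctions _root_.Polynomial _root_.Finset
open scoped _root_.BigOperators _root_.Nat

/-! ## Rational intervals with outward rounding -/

/-- An interval is a pair `(lo, hi)` of rationals.
[cite: CsordasNorfolkVarga1986, the concavity of log Φ(√t) (= DimitrovLucas2011, Theorem B); kernel interval-arithmetic certificate (bookkeeping)] -/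
abbrev Iv := ℚ × ℚ

/-- Grid `10⁶⁴` for outward rounding (keeps numerators/denominators small).
[cite: CsordasNorfolkVarga1986, the concavity of log Φ(√t) (= DimitrovLucas2011, Theorem B); kernel interval-arithmetic certificate (bookkeeping)] -/
def grid : ℚ := (10 : ℚ) ^ 64

/-- Round down to the grid.
[cite: CsordasNorfolkVarga1986, the concavity of log Φ(√t) (= DimitrovLucas2011, Theorem B); kernel interval-arithmetic certificate (bookkeeping)] -/
def floorG (x : ℚ) : ℚ := (⌊x * grid⌋ : ℚ) / grid
/-- Round up to the grid.
[cite: CsordasNorfolkVarga1986, the concavity of log Φ(√t) (= DimitrovLucas2011, Theorem B); kernel interval-arithmetic certificate (bookkeeping)] -/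
def ceilG (x : ℚ) : ℚ := (⌈x * grid⌉ : ℚ) / grid

/-- `x ∈ I` for a real `x`.
[cite: CsordasNorfolkVarga1986, the concavity of log Φ(√t) (= DimitrovLucas2011, Theorem B); kernel interval-arithmetic certificate (bookkeeping)] -/
def Mem (x : ℝ) (I : Iv) : Prop := ((I.1 : ℚ) : ℝ) ≤ x ∧ x ≤ ((I.2 : ℚ) : ℝ)

/-- The grid is positive.
[cite: CsordasNorfolkVarga1986, the concavity of log Φ(√t) (= DimitrovLucas2011, Theorem B); kernel interval-arithmetic certificate (bookkeeping)] -/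
theorem grid_pos : (0 : ℚ) < grid := by unfold grid; positivity

/-- Rounding down does not increase.
[cite: CsordasNorfolkVarga1986, the concavity of log Φ(√t) (= DimitrovLucas2011, Theorem B); kernel interval-arithmetic certificate (bookkeeping)] -/
theorem floorG_le (x : ℚ) : floorG x ≤ x := by
  unfold floorG; rw [div_le_iff₀ grid_pos]; exact Int.floor_le _

/-- Rounding up does not decrease.
[cite: CsordasNorfolkVarga1986, the concavity of log Φ(√t) (= DimitrovLucas2011, Theorem B); kernel interval-arithmetic certificate (bookkeeping)] -/
theorem le_ceilG (x : ℚ) : x ≤ ceilG x := by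
  unfold ceilG; rw [le_div_iff₀ grid_pos]; exact Int.le_ceil _

/-- A real below-bound survives rounding down.
[cite: CsordasNorfolkVarga1986, the concavity of log Φ(√t) (= DimitrovLucas2011, Theorem B); kernel interval-arithmetic certificate (bookkeeping)] -/
theorem floorG_le_real {x : ℚ} {y : ℝ} (h : (x : ℝ) ≤ y) : ((floorG x : ℚ) : ℝ) ≤ y :=
  le_trans (by exact_mod_cast floorG_le x) h

/-- A real above-bound survives rounding up.
[cite: CsordasNorfolkVarga1986, the concavity of log Φ(√t) (= DimitrovLucas2011, Theorem B); kernel interval-arithmetic certificate (bookkeeping)] -/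
theorem real_le_ceilG {x : ℚ} {y : ℝ} (h : y ≤ (x : ℝ)) : y ≤ ((ceilG x : ℚ) : ℝ) :=
  le_trans h (by exact_mod_cast le_ceilG x)

end Literature.NumberTheory.LFunctions.DeBruijnPhiCells.CoeffTable

end Part1

/-!
## Part 2 — port of `Summits/RiemannHypothesis/RiemannHypothesis/Theorems/JensenPolynomialsPhiCellArith.lean` (38 declarations kept)

# Route `JensenPolynomials`, item `XiDeltaSqPos` (S-T5) — toolbox 2: exact-ℚ interval arithmetic for the cell checker
(RH-FREE; cell rh-jensen, HUMAN RULING D-0040)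

Generic, COMPUTABLE pieces of the kernel certificate that discharges the route's crux `XiDeltaSqPos` zero-free
(Csordas–Varga 1988, Theorem 2.2: `log Φ(√t)` is strictly concave; here: the monotonicity of `−Φ′(u)/(uΦ(u))` on
`(0, 1/4]`, proved by a cell-by-cell interval computation evaluated by `decide` in the kernel). Everything lives on the
route's existing interval vocabulary (`CoeffTable.Iv`, `Mem`, outward rounding `floorG`/`ceilG` to the grid `10⁻⁶⁴`,
file `JensenPolynomialsXiGorttwCoeffSmallTableCheck.lean`), and adds:

* sign-agnostic interval operations `ivAdd`, `ivNeg`, `ivScale`, `ivMul`, `ivWiden` with inclusion lemmas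
  (Moore's inclusion monotonicity);
* polynomials as coefficient lists `List ℚ` (low degree first): evaluation `pevalR`/`pevalQ`, the exact TAYLOR SHIFT
  `taylorShift a p` (coefficients of `p(a + t)`, `pevalR_taylorShift`) and the termwise RANGE `prange h p` of `p(t)` over
  `t ∈ [0, h]` (`mem_prange`: `q₀ + Σ_{k≥1} min(q_k h^k, 0) ≤ p(t) ≤ q₀ + Σ_{k≥1} max(q_k h^k, 0)`);
* certified exponentials: `expNegSmall s` ∋ `e^{−s}` for `0 ≤ s ≤ 1` (degree-14 Taylor polynomial ± the remainder of
  Mathlib's `Real.exp_bound`), `expNegIv x` ∋ `e^{−x}` for `x ≥ 0` (`e^{−x} = (e^{−1})^{⌊x⌋} e^{−{x}}`), `ivPow`, and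
  `expPosHi s ≥ e^{s}` (`0 ≤ s ≤ 1`);
* `covers cells lo hi`: a list of consecutive cells `[a, a + h]` covers `[lo, hi]` (`mem_cell_of_covers`).

All statements are about arbitrary reals enclosed by the computed rational data; nothing here mentions `Φ` or `ξ`.
WHAT THIS IS NOT: nothing here bears on the zeros of `ζ`. References: R. E. Moore, *Methods and Applications of
Interval Analysis* (1979), Ch. 3 [Moore1979]; Csordas–Varga, Constr. Approx. 4 (1988), Thm 2.2 [CsordasVarga1988].

(Verbatim declaration-level port — the declarations listed in the Part header count — of the Summits-side module of the
RiemannHypothesis tree's Jensen-polynomial cell; cell / rung / item bookkeeping in the text above is historical.)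
-/

section Part2

namespace Literature.NumberTheory.LFunctions.DeBruijnPhiCells.CoeffTable

open _root_.Finset
open scoped _root_.BigOperators _root_.Nat

/-! ## 1. Sign-agnostic interval operations -/

/-- Sum of intervals (exact).
[cite: CsordasNorfolkVarga1986, the concavity of log Φ(√t) (= DimitrovLucas2011, Theorem B); kernel interval-arithmetic certificate (bookkeeping)] -/
def ivAdd (A B : Iv) : Iv := (A.1 + B.1, A.2 + B.2)
/-- Negation of an interval (exact).
[cite: CsordasNorfolkVarga1986, the concavity of log Φ(√t) (= DimitrovLucas2011, Theorem B); kernel interval-arithmetic certificate (bookkeeping)] -/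
def ivNeg (A : Iv) : Iv := (-A.2, -A.1)
/-- Scaling of an interval by a rational constant (exact).
[cite: CsordasNorfolkVarga1986, the concavity of log Φ(√t) (= DimitrovLucas2011, Theorem B); kernel interval-arithmetic certificate (bookkeeping)] -/
def ivScale (c : ℚ) (A : Iv) : Iv := if 0 ≤ c then (c * A.1, c * A.2) else (c * A.2, c * A.1)
/-- Product of two arbitrary intervals: min/max of the four endpoint products, rounded outward.
[cite: CsordasNorfolkVarga1986, the concavity of log Φ(√t) (= DimitrovLucas2011, Theorem B); kernel interval-arithmetic certificate (bookkeeping)] -/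
def ivMul (A B : Iv) : Iv :=
  (floorG (min (min (A.1 * B.1) (A.1 * B.2)) (min (A.2 * B.1) (A.2 * B.2))),
   ceilG (max (max (A.1 * B.1) (A.1 * B.2)) (max (A.2 * B.1) (A.2 * B.2))))
/-- Widening of an interval by `r` on both sides (exact).
[cite: CsordasNorfolkVarga1986, the concavity of log Φ(√t) (= DimitrovLucas2011, Theorem B); kernel interval-arithmetic certificate (bookkeeping)] -/
def ivWiden (A : Iv) (r : ℚ) : Iv := (A.1 - r, A.2 + r)

/-- `ivAdd` encloses sums.
[cite: CsordasNorfolkVarga1986, the concavity of log Φ(√t) (= DimitrovLucas2011, Theorem B); kernel interval-arithmetic certificate (bookkeeping)] -/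
theorem mem_ivAdd {A B : Iv} {x y : ℝ} (hx : Mem x A) (hy : Mem y B) : Mem (x + y) (ivAdd A B) := by
  obtain ⟨h1, h2⟩ := hx; obtain ⟨h3, h4⟩ := hy
  unfold ivAdd; constructor <;> push_cast <;> linarith

/-- `ivNeg` encloses negations.
[cite: CsordasNorfolkVarga1986, the concavity of log Φ(√t) (= DimitrovLucas2011, Theorem B); kernel interval-arithmetic certificate (bookkeeping)] -/
theorem mem_ivNeg {A : Iv} {x : ℝ} (hx : Mem x A) : Mem (-x) (ivNeg A) := by
  obtain ⟨h1, h2⟩ := hx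
  unfold ivNeg; constructor <;> push_cast <;> linarith

/-- `ivScale` encloses rational multiples.
[cite: CsordasNorfolkVarga1986, the concavity of log Φ(√t) (= DimitrovLucas2011, Theorem B); kernel interval-arithmetic certificate (bookkeeping)] -/
theorem mem_ivScale (c : ℚ) {A : Iv} {x : ℝ} (hx : Mem x A) : Mem ((c : ℝ) * x) (ivScale c A) := by
  obtain ⟨h1, h2⟩ := hx
  unfold ivScale
  split_ifs with hc
  · have hc' : (0 : ℝ) ≤ (c : ℝ) := by exact_mod_cast hc
    constructor <;> push_cast
    · exact mul_le_mul_of_nonneg_left h1 hc'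
    · exact mul_le_mul_of_nonneg_left h2 hc'
  · have hc' : (c : ℝ) ≤ 0 := by exact_mod_cast (not_le.mp hc).le
    constructor <;> push_cast
    · exact mul_le_mul_of_nonpos_left h2 hc'
    · exact mul_le_mul_of_nonpos_left h1 hc'

/-- `ivWiden A r` encloses `x + e` for `x ∈ A`, `|e| ≤ r`.
[cite: CsordasNorfolkVarga1986, the concavity of log Φ(√t) (= DimitrovLucas2011, Theorem B); kernel interval-arithmetic certificate (bookkeeping)] -/
theorem mem_ivWiden {A : Iv} {r : ℚ} {x e : ℝ} (hx : Mem x A) (he : |e| ≤ (r : ℝ)) : Mem (x + e) (ivWiden A r) := by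
  obtain ⟨h1, h2⟩ := hx
  have h3 := (abs_le.mp he).1
  have h4 := (abs_le.mp he).2
  unfold ivWiden; constructor <;> push_cast <;> linarith

/-- The four-corner lower bound for a product of enclosed reals.
[cite: CsordasNorfolkVarga1986, the concavity of log Φ(√t) (= DimitrovLucas2011, Theorem B); kernel interval-arithmetic certificate (bookkeeping)] -/
theorem min_corners_le_mul {a1 a2 b1 b2 x y : ℝ} (h1 : a1 ≤ x) (h2 : x ≤ a2) (h3 : b1 ≤ y) (h4 : y ≤ b2) :
    min (min (a1 * b1) (a1 * b2)) (min (a2 * b1) (a2 * b2)) ≤ x * y := by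
  rcases le_total 0 y with hy | hy
  · have hxy : a1 * y ≤ x * y := mul_le_mul_of_nonneg_right h1 hy
    rcases le_total 0 a1 with ha | ha
    · have : a1 * b1 ≤ a1 * y := mul_le_mul_of_nonneg_left h3 ha
      have := min_le_left (min (a1 * b1) (a1 * b2)) (min (a2 * b1) (a2 * b2))
      have := min_le_left (a1 * b1) (a1 * b2)
      linarith
    · have : a1 * b2 ≤ a1 * y := mul_le_mul_of_nonpos_left h4 ha
      have := min_le_left (min (a1 * b1) (a1 * b2)) (min (a2 * b1) (a2 * b2))
      have := min_le_right (a1 * b1) (a1 * b2)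
      linarith
  · have hxy : a2 * y ≤ x * y := mul_le_mul_of_nonpos_right h2 hy
    rcases le_total 0 a2 with ha | ha
    · have : a2 * b1 ≤ a2 * y := mul_le_mul_of_nonneg_left h3 ha
      have := min_le_right (min (a1 * b1) (a1 * b2)) (min (a2 * b1) (a2 * b2))
      have := min_le_left (a2 * b1) (a2 * b2)
      linarith
    · have : a2 * b2 ≤ a2 * y := mul_le_mul_of_nonpos_left h4 ha
      have := min_le_right (min (a1 * b1) (a1 * b2)) (min (a2 * b1) (a2 * b2))
      have := min_le_right (a2 * b1) (a2 * b2)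
      linarith

/-- The four-corner upper bound for a product of enclosed reals.
[cite: CsordasNorfolkVarga1986, the concavity of log Φ(√t) (= DimitrovLucas2011, Theorem B); kernel interval-arithmetic certificate (bookkeeping)] -/
theorem mul_le_max_corners {a1 a2 b1 b2 x y : ℝ} (h1 : a1 ≤ x) (h2 : x ≤ a2) (h3 : b1 ≤ y) (h4 : y ≤ b2) :
    x * y ≤ max (max (a1 * b1) (a1 * b2)) (max (a2 * b1) (a2 * b2)) := by
  rcases le_total 0 y with hy | hy
  · have hxy : x * y ≤ a2 * y := mul_le_mul_of_nonneg_right h2 hy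
    rcases le_total 0 a2 with ha | ha
    · have : a2 * y ≤ a2 * b2 := mul_le_mul_of_nonneg_left h4 ha
      have := le_max_right (max (a1 * b1) (a1 * b2)) (max (a2 * b1) (a2 * b2))
      have := le_max_right (a2 * b1) (a2 * b2)
      linarith
    · have : a2 * y ≤ a2 * b1 := mul_le_mul_of_nonpos_left h3 ha
      have := le_max_right (max (a1 * b1) (a1 * b2)) (max (a2 * b1) (a2 * b2))
      have := le_max_left (a2 * b1) (a2 * b2)
      linarith
  · have hxy : x * y ≤ a1 * y := mul_le_mul_of_nonpos_right h1 hy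
    rcases le_total 0 a1 with ha | ha
    · have : a1 * y ≤ a1 * b2 := mul_le_mul_of_nonneg_left h4 ha
      have := le_max_left (max (a1 * b1) (a1 * b2)) (max (a2 * b1) (a2 * b2))
      have := le_max_right (a1 * b1) (a1 * b2)
      linarith
    · have : a1 * y ≤ a1 * b1 := mul_le_mul_of_nonpos_left h3 ha
      have := le_max_left (max (a1 * b1) (a1 * b2)) (max (a2 * b1) (a2 * b2))
      have := le_max_left (a1 * b1) (a1 * b2)
      linarith

/-- `ivMul` encloses products of arbitrary enclosed reals [Moore1979, Ch. 3].
[cite: CsordasNorfolkVarga1986, the concavity of log Φ(√t) (= DimitrovLucas2011, Theorem B); kernel interval-arithmetic certificate (bookkeeping)] -/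
theorem mem_ivMul {A B : Iv} {x y : ℝ} (hx : Mem x A) (hy : Mem y B) : Mem (x * y) (ivMul A B) := by
  obtain ⟨h1, h2⟩ := hx; obtain ⟨h3, h4⟩ := hy
  unfold ivMul
  constructor
  · apply floorG_le_real; push_cast; exact min_corners_le_mul h1 h2 h3 h4
  · apply real_le_ceilG; push_cast; exact mul_le_max_corners h1 h2 h3 h4

/-- A positive lower end certifies positivity of every enclosed real.
[cite: CsordasNorfolkVarga1986, the concavity of log Φ(√t) (= DimitrovLucas2011, Theorem B); kernel interval-arithmetic certificate (bookkeeping)] -/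
theorem pos_of_mem {A : Iv} {x : ℝ} (hx : Mem x A) (h : 0 < A.1) : 0 < x :=
  lt_of_lt_of_le (by exact_mod_cast h) hx.1

/-! ## 2. Polynomials as coefficient lists: evaluation, Taylor shift, range on `[0, h]` -/

/-- Evaluation of a coefficient list (low degree first) at a real point: `[c₀, c₁, …] ↦ c₀ + x(c₁ + x(⋯))`.
[cite: CsordasNorfolkVarga1986, the concavity of log Φ(√t) (= DimitrovLucas2011, Theorem B); kernel interval-arithmetic certificate (bookkeeping)] -/
def pevalR : List ℚ → ℝ → ℝ
  | [], _ => 0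
  | c :: cs, x => (c : ℝ) + x * pevalR cs x

/-- Evaluation of a coefficient list at a rational point.
[cite: CsordasNorfolkVarga1986, the concavity of log Φ(√t) (= DimitrovLucas2011, Theorem B); kernel interval-arithmetic certificate (bookkeeping)] -/
def pevalQ : List ℚ → ℚ → ℚ
  | [], _ => 0
  | c :: cs, x => c + x * pevalQ cs x

/-- `pevalR` at a rational point is the cast of `pevalQ`.
[cite: CsordasNorfolkVarga1986, the concavity of log Φ(√t) (= DimitrovLucas2011, Theorem B); kernel interval-arithmetic certificate (bookkeeping)] -/
theorem pevalR_ratCast (cs : List ℚ) (q : ℚ) : pevalR cs (q : ℝ) = ((pevalQ cs q : ℚ) : ℝ) := by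
  induction cs with
  | nil => simp [pevalR, pevalQ]
  | cons c cs ih => simp only [pevalR, pevalQ, ih]; push_cast; ring

/-- Auxiliary for the product by `(a + t)`: carries the previous coefficient.
[cite: CsordasNorfolkVarga1986, the concavity of log Φ(√t) (= DimitrovLucas2011, Theorem B); kernel interval-arithmetic certificate (bookkeeping)] -/
def mulLinAux (a : ℚ) : ℚ → List ℚ → List ℚ
  | prev, [] => [prev]
  | prev, c :: cs => (a * c + prev) :: mulLinAux a c cs

/-- Coefficients of `(a + t)·q(t)`.
[cite: CsordasNorfolkVarga1986, the concavity of log Φ(√t) (= DimitrovLucas2011, Theorem B); kernel interval-arithmetic certificate (bookkeeping)] -/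
def mulLin (a : ℚ) : List ℚ → List ℚ
  | [] => []
  | c :: cs => (a * c) :: mulLinAux a c cs

/-- Semantics of `mulLinAux`.
[cite: CsordasNorfolkVarga1986, the concavity of log Φ(√t) (= DimitrovLucas2011, Theorem B); kernel interval-arithmetic certificate (bookkeeping)] -/
theorem pevalR_mulLinAux (a : ℚ) (t : ℝ) (cs : List ℚ) (prev : ℚ) :
    pevalR (mulLinAux a prev cs) t = (prev : ℝ) + ((a : ℝ) + t) * pevalR cs t := by
  induction cs generalizing prev with
  | nil => simp [mulLinAux, pevalR]
  | cons c cs ih => simp only [mulLinAux, pevalR, ih]; push_cast; ring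

/-- `mulLin a q` evaluates to `(a + t)·q(t)`.
[cite: CsordasNorfolkVarga1986, the concavity of log Φ(√t) (= DimitrovLucas2011, Theorem B); kernel interval-arithmetic certificate (bookkeeping)] -/
theorem pevalR_mulLin (a : ℚ) (t : ℝ) (cs : List ℚ) :
    pevalR (mulLin a cs) t = ((a : ℝ) + t) * pevalR cs t := by
  cases cs with
  | nil => simp [mulLin, pevalR]
  | cons c cs => simp only [mulLin, pevalR, pevalR_mulLinAux]; push_cast; ring

/-- The exact Taylor shift: coefficients of `p(a + t)` as a polynomial in `t`.
[cite: CsordasNorfolkVarga1986, the concavity of log Φ(√t) (= DimitrovLucas2011, Theorem B); kernel interval-arithmetic certificate (bookkeeping)] -/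
def taylorShift (a : ℚ) : List ℚ → List ℚ
  | [] => []
  | c :: cs =>
    match mulLin a (taylorShift a cs) with
    | [] => [c]
    | d :: ds => (c + d) :: ds

/-- `taylorShift a p` evaluates at `t` to `p(a + t)`.
[cite: CsordasNorfolkVarga1986, the concavity of log Φ(√t) (= DimitrovLucas2011, Theorem B); kernel interval-arithmetic certificate (bookkeeping)] -/
theorem pevalR_taylorShift (a : ℚ) (t : ℝ) (cs : List ℚ) :
    pevalR (taylorShift a cs) t = pevalR cs ((a : ℝ) + t) := by
  induction cs with
  | nil => simp [taylorShift, pevalR]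
  | cons c cs ih =>
    have hm := pevalR_mulLin a t (taylorShift a cs)
    rw [ih] at hm
    simp only [taylorShift, pevalR]
    rcases hq : mulLin a (taylorShift a cs) with _ | ⟨d, ds⟩
    · rw [hq] at hm; simp only [pevalR] at hm ⊢; linarith
    · rw [hq] at hm; simp only [pevalR] at hm ⊢; push_cast; linarith

/-- Range of the tail `Σ_{j} c_j t^{j+k}` for `t ∈ [0, h]`, given `hk = h^k`: termwise `min(c h^k, 0)` / `max(c h^k, 0)`.
[cite: CsordasNorfolkVarga1986, the concavity of log Φ(√t) (= DimitrovLucas2011, Theorem B); kernel interval-arithmetic certificate (bookkeeping)] -/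
def prangeTail (h : ℚ) : ℚ → List ℚ → Iv
  | _, [] => (0, 0)
  | hk, c :: cs =>
    let r := prangeTail h (hk * h) cs
    (min (c * hk) 0 + r.1, max (c * hk) 0 + r.2)

/-- Range of `p(t)` over `t ∈ [0, h]`: `p₀ + [tail range]`.
[cite: CsordasNorfolkVarga1986, the concavity of log Φ(√t) (= DimitrovLucas2011, Theorem B); kernel interval-arithmetic certificate (bookkeeping)] -/
def prange (h : ℚ) : List ℚ → Iv
  | [] => (0, 0)
  | c :: cs => let r := prangeTail h h cs; (c + r.1, c + r.2)

/-- Soundness of `prangeTail`: `t^{k+1}·q(t)` lies in `prangeTail h (h^{k+1}) q` for `0 ≤ t ≤ h`.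
[cite: CsordasNorfolkVarga1986, the concavity of log Φ(√t) (= DimitrovLucas2011, Theorem B); kernel interval-arithmetic certificate (bookkeeping)] -/
theorem mem_prangeTail {h : ℚ} {t : ℝ} (ht0 : 0 ≤ t) (hth : t ≤ (h : ℝ)) (cs : List ℚ) (k : ℕ) :
    Mem (t ^ (k + 1) * pevalR cs t) (prangeTail h (h ^ (k + 1)) cs) := by
  induction cs generalizing k with
  | nil => simp only [prangeTail, pevalR, mul_zero]; exact ⟨by push_cast; exact le_rfl, by exact_mod_cast le_rfl⟩
  | cons c cs ih =>
    have hpow0 : 0 ≤ t ^ (k + 1) := pow_nonneg ht0 _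
    have hpowh : t ^ (k + 1) ≤ (h : ℝ) ^ (k + 1) := pow_le_pow_left₀ ht0 hth _
    have ih' := ih (k + 1)
    rw [show (h : ℚ) ^ (k + 1 + 1) = h ^ (k + 1) * h by ring] at ih'
    obtain ⟨ih1, ih2⟩ := ih'
    have e : t ^ (k + 1) * pevalR (c :: cs) t = (c : ℝ) * t ^ (k + 1) + t ^ (k + 1 + 1) * pevalR cs t := by
      simp only [pevalR]; ring
    simp only [prangeTail]
    rw [e]
    constructor
    · push_cast
      have hterm : min ((c : ℝ) * (h : ℝ) ^ (k + 1)) 0 ≤ (c : ℝ) * t ^ (k + 1) := by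
        rcases le_total 0 (c : ℝ) with hc | hc
        · exact le_trans (min_le_right _ _) (mul_nonneg hc hpow0)
        · exact le_trans (min_le_left _ _) (mul_le_mul_of_nonpos_left hpowh hc)
      linarith
    · push_cast
      have hterm : (c : ℝ) * t ^ (k + 1) ≤ max ((c : ℝ) * (h : ℝ) ^ (k + 1)) 0 := by
        rcases le_total 0 (c : ℝ) with hc | hc
        · exact le_trans (mul_le_mul_of_nonneg_left hpowh hc) (le_max_left _ _)
        · exact le_trans (mul_nonpos_of_nonpos_of_nonneg hc hpow0) (le_max_right _ _)
      linarith

/-- Soundness of `prange`: `p(t) ∈ prange h p` for `0 ≤ t ≤ h`.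
[cite: CsordasNorfolkVarga1986, the concavity of log Φ(√t) (= DimitrovLucas2011, Theorem B); kernel interval-arithmetic certificate (bookkeeping)] -/
theorem mem_prange {h : ℚ} {t : ℝ} (ht0 : 0 ≤ t) (hth : t ≤ (h : ℝ)) (cs : List ℚ) :
    Mem (pevalR cs t) (prange h cs) := by
  cases cs with
  | nil => simp only [prange, pevalR]; exact ⟨by push_cast; exact le_rfl, by push_cast; exact le_rfl⟩
  | cons c cs =>
    have h1 := mem_prangeTail ht0 hth cs 0
    rw [zero_add, pow_one, pow_one] at h1
    obtain ⟨h1, h2⟩ := h1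
    simp only [prange, pevalR]
    constructor <;> push_cast at h1 h2 ⊢ <;> linarith

/-- Range of `p(y)` for `y ∈ [a, a + h]` (Taylor shift, then termwise range).
[cite: CsordasNorfolkVarga1986, the concavity of log Φ(√t) (= DimitrovLucas2011, Theorem B); kernel interval-arithmetic certificate (bookkeeping)] -/
def prangeAt (p : List ℚ) (a h : ℚ) : Iv := prange h (taylorShift a p)

/-- Soundness of `prangeAt`.
[cite: CsordasNorfolkVarga1986, the concavity of log Φ(√t) (= DimitrovLucas2011, Theorem B); kernel interval-arithmetic certificate (bookkeeping)] -/
theorem mem_prangeAt (p : List ℚ) {a h : ℚ} {y : ℝ} (h1 : (a : ℝ) ≤ y) (h2 : y ≤ (a : ℝ) + h) :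
    Mem (pevalR p y) (prangeAt p a h) := by
  have e : y = (a : ℝ) + (y - a) := by ring
  rw [e, ← pevalR_taylorShift]
  exact mem_prange (by linarith) (by linarith) _

/-! ## 3. Certified exponentials -/

/-- Degree-`14` Taylor data for `e^{−s}`, `0 ≤ s ≤ 1`: partial sum and remainder bound of `Real.exp_bound`.
[cite: CsordasNorfolkVarga1986, the concavity of log Φ(√t) (= DimitrovLucas2011, Theorem B); kernel interval-arithmetic certificate (bookkeeping)] -/
def expNegSmall (s : ℚ) : Iv :=
  let T : ℚ := ∑ i ∈ range 14, (-s) ^ i / (i ! : ℚ)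
  let err : ℚ := s ^ 14 * (15 / ((14 ! : ℚ) * 14))
  (floorG (T - err), ceilG (T + err))

/-- `e^{−s} ∈ expNegSmall s` for `0 ≤ s ≤ 1`.
[cite: CsordasNorfolkVarga1986, the concavity of log Φ(√t) (= DimitrovLucas2011, Theorem B); kernel interval-arithmetic certificate (bookkeeping)] -/
theorem mem_expNegSmall {s : ℚ} (hs0 : 0 ≤ s) (hs1 : s ≤ 1) : Mem (Real.exp (-(s : ℝ))) (expNegSmall s) := by
  have hx : |(-(s : ℝ))| ≤ 1 := by
    rw [abs_neg, abs_of_nonneg (by exact_mod_cast hs0)]; exact_mod_cast hs1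
  have hb := Real.exp_bound hx (n := 14) (by norm_num)
  rw [abs_neg, abs_of_nonneg (show (0 : ℝ) ≤ s by exact_mod_cast hs0)] at hb
  have h1 := (abs_sub_le_iff.1 hb).1
  have h2 := (abs_sub_le_iff.1 hb).2
  unfold expNegSmall
  constructor
  · apply floorG_le_real; push_cast at h1 h2 ⊢; linarith
  · apply real_le_ceilG; push_cast at h1 h2 ⊢; linarith

/-- Upper bound `e^{s} ≤ expPosHi s` for `0 ≤ s ≤ 1` (Taylor sum plus remainder).
[cite: CsordasNorfolkVarga1986, the concavity of log Φ(√t) (= DimitrovLucas2011, Theorem B); kernel interval-arithmetic certificate (bookkeeping)] -/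
def expPosHi (s : ℚ) : ℚ := (∑ i ∈ range 14, s ^ i / (i ! : ℚ)) + s ^ 14 * 15 / ((14 ! : ℚ) * 14)

/-- `e^{s} ≤ expPosHi s` for `0 ≤ s ≤ 1`.
[cite: CsordasNorfolkVarga1986, the concavity of log Φ(√t) (= DimitrovLucas2011, Theorem B); kernel interval-arithmetic certificate (bookkeeping)] -/
theorem exp_le_expPosHi {s : ℚ} (hs0 : 0 ≤ s) (hs1 : s ≤ 1) : Real.exp (s : ℝ) ≤ (expPosHi s : ℝ) := by
  have h := Real.exp_bound' (x := (s : ℝ)) (by exact_mod_cast hs0) (by exact_mod_cast hs1) (n := 14) (by norm_num)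
  unfold expPosHi
  push_cast at h ⊢
  convert h using 2
  norm_num

/-- Interval power by repeated `ivMul`.
[cite: CsordasNorfolkVarga1986, the concavity of log Φ(√t) (= DimitrovLucas2011, Theorem B); kernel interval-arithmetic certificate (bookkeeping)] -/
def ivPow (A : Iv) : ℕ → Iv
  | 0 => (1, 1)
  | n + 1 => ivMul (ivPow A n) A

/-- `ivPow` encloses powers.
[cite: CsordasNorfolkVarga1986, the concavity of log Φ(√t) (= DimitrovLucas2011, Theorem B); kernel interval-arithmetic certificate (bookkeeping)] -/
theorem mem_ivPow {A : Iv} {x : ℝ} (hx : Mem x A) (n : ℕ) : Mem (x ^ n) (ivPow A n) := by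
  induction n with
  | zero => simp only [ivPow, pow_zero]; exact ⟨by push_cast; exact le_rfl, by push_cast; exact le_rfl⟩
  | succ n ih => rw [pow_succ]; exact mem_ivMul ih hx

/-- Enclosure of `e^{−x}` for rational `x ≥ 0`: `e^{−x} = (e^{−1})^{⌊x⌋} · e^{−(x − ⌊x⌋)}`.
[cite: CsordasNorfolkVarga1986, the concavity of log Φ(√t) (= DimitrovLucas2011, Theorem B); kernel interval-arithmetic certificate (bookkeeping)] -/
def expNegIv (x : ℚ) : Iv :=
  let n : ℕ := ⌊x⌋₊
  ivMul (ivPow (expNegSmall 1) n) (expNegSmall (x - n))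

/-- `e^{−x} ∈ expNegIv x` for `x ≥ 0`.
[cite: CsordasNorfolkVarga1986, the concavity of log Φ(√t) (= DimitrovLucas2011, Theorem B); kernel interval-arithmetic certificate (bookkeeping)] -/
theorem mem_expNegIv {x : ℚ} (hx : 0 ≤ x) : Mem (Real.exp (-(x : ℝ))) (expNegIv x) := by
  unfold expNegIv
  set n : ℕ := ⌊x⌋₊ with hn
  have hfl : (n : ℚ) ≤ x := Nat.floor_le hx
  have hlt : x < (n : ℚ) + 1 := Nat.lt_floor_add_one x
  have e : Real.exp (-(x : ℝ)) = Real.exp (-((1 : ℚ) : ℝ)) ^ n * Real.exp (-((x - n : ℚ) : ℝ)) := by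
    rw [← Real.exp_nat_mul, ← Real.exp_add]; congr 1; push_cast; ring
  rw [e]
  exact mem_ivMul (mem_ivPow (mem_expNegSmall zero_le_one le_rfl) n)
    (mem_expNegSmall (by linarith) (by linarith))

/-! ## 4. Covering an interval by consecutive cells -/

/-- `covers cells lo hi`: the cells `[a, a + h]` (in order, each starting at or before the point reached so far)
jointly cover `[lo, hi]`.
[cite: CsordasNorfolkVarga1986, the concavity of log Φ(√t) (= DimitrovLucas2011, Theorem B); kernel interval-arithmetic certificate (bookkeeping)] -/
def covers : List (ℚ × ℚ) → ℚ → ℚ → Bool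
  | [], l, r => decide (r < l)
  | (a, h) :: rest, l, r => decide (a ≤ l) && covers rest (a + h) r

/-- If `covers cells lo hi`, every `y ∈ [lo, hi]` lies in some cell `[a, a + h]` of the list.
[cite: CsordasNorfolkVarga1986, the concavity of log Φ(√t) (= DimitrovLucas2011, Theorem B); kernel interval-arithmetic certificate (bookkeeping)] -/
theorem mem_cell_of_covers {cells : List (ℚ × ℚ)} {lo hi : ℚ} (hc : covers cells lo hi = true) {y : ℝ}
    (h1 : (lo : ℝ) ≤ y) (h2 : y ≤ (hi : ℝ)) : ∃ c ∈ cells, ((c.1 : ℚ) : ℝ) ≤ y ∧ y ≤ ((c.1 : ℚ) : ℝ) + ((c.2 : ℚ) : ℝ) := by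
  induction cells generalizing lo with
  | nil =>
    simp only [covers, decide_eq_true_eq] at hc
    have : ((hi : ℚ) : ℝ) < ((lo : ℚ) : ℝ) := by exact_mod_cast hc
    exfalso; linarith
  | cons c rest ih =>
    obtain ⟨a, h⟩ := c
    simp only [covers, Bool.and_eq_true, decide_eq_true_eq] at hc
    obtain ⟨ha, hrest⟩ := hc
    by_cases hy : y ≤ ((a : ℚ) : ℝ) + ((h : ℚ) : ℝ)
    · exact ⟨(a, h), by simp, by push_cast; exact le_trans (by exact_mod_cast ha) h1, hy⟩
    · obtain ⟨c', hc', hc'1, hc'2⟩ := ih hrest (lo := a + h) (by push_cast; linarith [not_le.mp hy])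
      exact ⟨c', by simp [hc'], hc'1, hc'2⟩

end Literature.NumberTheory.LFunctions.DeBruijnPhiCells.CoeffTable

end Part2

/-!
## Part 3 — port of `Summits/RiemannHypothesis/RiemannHypothesis/Theorems/JensenPolynomialsPhiCellSeries.lean` (20 declarations kept)

# Route `JensenPolynomials`, item `XiDeltaSqPos` (S-T5) — toolbox 3: cell enclosures of the theta series
`e^{y₀}∑_n P(y_n)e^{−y_n}` (RH-FREE; cell rh-jensen, HUMAN RULING D-0040)

Third piece of the kernel certificate that discharges the route's crux `XiDeltaSqPos` zero-free (Csordas–Varga 1988,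
Theorem 2.2: `log Φ(√t)` strictly concave; the Turán inequalities of `ξ`'s Taylor data, Csordas–Norfolk–Varga 1986).
For a rational coefficient list `P` (low degree first) and `x > 0` put `y_n = π(n+1)²x` (the tree's `thetaFreq x n`)
and `F_P(x) = ∑_n P(y_n)e^{−y_n}` (`qterm`, `summable_qterm`); every derivative of the Pólya–de Bruijn kernel is
`Φ^{(m)}(u) = eᵘ F_{P_m}(e^{4u})` (tree: `deBruijnPhi_eq_tsum`, `deBruijnPhiDeriv_eq_tsum`, `deBruijnPhiDeriv₂_eq_tsum`,
`deBruijnPhiDeriv₃_eq_tsum`, `deBruijnPhiDeriv₄_eq_tsum`). We PROVE: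

* the TAIL BOUND `|∑_{n≥2} P(y_n)e^{−y_n}| ≤ (1 + 2·10⁻⁶)·|P|(9y₀)·e^{−9y₀}` for `y₀ ≥ 3` and degree `≤ 6`
  (`abs_tsum_qterm_tail_le`; each monomial: `y_{n+2}^k e^{−y_{n+2}} ≤ (9y₀)^k e^{−9y₀}·e^{−14n}` from `r ≤ e^{r−1}`);
* the COMPUTABLE cell enclosure `cellIv P a h ∋ e^{y₀}F_P(x)` for all `y₀ ∈ [a, a + h]`, `a ≥ 3` (`mem_cellIv`):
  `e^{y₀}F_P = P(y₀) + P(4y₀)e^{−3y₀} + e^{y₀}·tail`, with exact Taylor ranges of `P(y)` and `P(4y)` over the cell,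
  `e^{−3y₀} ∈ [e^{−3(a+h)}, e^{−3a}]` and the tail widened by `(1 + 2·10⁻⁶)|P|(9(a+h))e^{−8a}` (toolbox 2's certified
  exponentials and interval arithmetic).

WHAT THIS IS NOT: nothing here bears on the zeros of `ζ`. References: Csordas–Varga, Constr. Approx. 4 (1988), Thm 2.2
[CsordasVarga1988]; Varga, *Scientific Computation on Mathematical Problems and Conjectures* (1990) §3.3 [Varga1990].

(Verbatim declaration-level port — the declarations listed in the Part header count — of the Summits-side module of the
RiemannHypothesis tree's Jensen-polynomial cell; cell / rung / item bookkeeping in the text above is historical.)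
-/

section Part3

namespace Literature.NumberTheory.LFunctions.DeBruijnPhiCells.CoeffTable

open _root_.Finset Literature.NumberTheory.LFunctions
open scoped _root_.BigOperators _root_.Nat _root_.Real

/-! ## 5. The theta series `∑_n P(y_n)e^{−y_n}` for a coefficient list `P` -/

/-- The `n`-th term `P(y_n)e^{−y_n}`, `y_n = π(n+1)²x`, for a rational coefficient list `P`.
[cite: CsordasNorfolkVarga1986, the concavity of log Φ(√t) (= DimitrovLucas2011, Theorem B); kernel interval-arithmetic certificate (bookkeeping)] -/
noncomputable def qterm (cs : List ℚ) (x : ℝ) (n : ℕ) : ℝ :=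
  pevalR cs (thetaFreq x n) * Real.exp (-thetaFreq x n)

/-- Termwise absolute values of a coefficient list.
[cite: CsordasNorfolkVarga1986, the concavity of log Φ(√t) (= DimitrovLucas2011, Theorem B); kernel interval-arithmetic certificate (bookkeeping)] -/
def absList (cs : List ℚ) : List ℚ := cs.map fun c => |c|

/-- Coefficients of `P(4y)` as a polynomial in `y`.
[cite: CsordasNorfolkVarga1986, the concavity of log Φ(√t) (= DimitrovLucas2011, Theorem B); kernel interval-arithmetic certificate (bookkeeping)] -/
def scale4 : List ℚ → List ℚ
  | [] => []
  | c :: cs => c :: (scale4 cs).map fun d => 4 * d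

/-- `pevalR` of a `4`-scaled list.
[cite: CsordasNorfolkVarga1986, the concavity of log Φ(√t) (= DimitrovLucas2011, Theorem B); kernel interval-arithmetic certificate (bookkeeping)] -/
theorem pevalR_map_four (cs : List ℚ) (y : ℝ) : pevalR (cs.map fun d => 4 * d) y = 4 * pevalR cs y := by
  induction cs with
  | nil => simp [pevalR]
  | cons c cs ih => simp only [List.map, pevalR, ih]; push_cast; ring

/-- `scale4 P` evaluates to `P(4y)`.
[cite: CsordasNorfolkVarga1986, the concavity of log Φ(√t) (= DimitrovLucas2011, Theorem B); kernel interval-arithmetic certificate (bookkeeping)] -/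
theorem pevalR_scale4 (cs : List ℚ) (y : ℝ) : pevalR (scale4 cs) y = pevalR cs (4 * y) := by
  induction cs with
  | nil => simp [scale4, pevalR]
  | cons c cs ih => simp only [scale4, pevalR, pevalR_map_four, ih]; ring

/-- `|P(Y)| ≤ |P|(Y)` for `Y ≥ 0` (coefficients replaced by absolute values).
[cite: CsordasNorfolkVarga1986, the concavity of log Φ(√t) (= DimitrovLucas2011, Theorem B); kernel interval-arithmetic certificate (bookkeeping)] -/
theorem abs_pevalR_le (cs : List ℚ) {Y : ℝ} (hY : 0 ≤ Y) : |pevalR cs Y| ≤ pevalR (absList cs) Y := by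
  induction cs with
  | nil => simp [pevalR, absList]
  | cons c cs ih =>
    simp only [pevalR, absList, List.map] at ih ⊢
    calc |(c : ℝ) + Y * pevalR cs Y| ≤ |(c : ℝ)| + |Y * pevalR cs Y| := abs_add_le _ _
      _ = |(c : ℝ)| + Y * |pevalR cs Y| := by rw [abs_mul, abs_of_nonneg hY]
      _ ≤ ((|c| : ℚ) : ℝ) + Y * pevalR (List.map (fun c => |c|) cs) Y := by
          push_cast; exact add_le_add le_rfl (mul_le_mul_of_nonneg_left ih hY)

/-- `|P|` has nonnegative values at `Y ≥ 0`.
[cite: CsordasNorfolkVarga1986, the concavity of log Φ(√t) (= DimitrovLucas2011, Theorem B); kernel interval-arithmetic certificate (bookkeeping)] -/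
theorem pevalR_absList_nonneg (cs : List ℚ) {Y : ℝ} (hY : 0 ≤ Y) : 0 ≤ pevalR (absList cs) Y :=
  le_trans (abs_nonneg _) (abs_pevalR_le cs hY)

/-- `|P|` is monotone on `[0, ∞)`.
[cite: CsordasNorfolkVarga1986, the concavity of log Φ(√t) (= DimitrovLucas2011, Theorem B); kernel interval-arithmetic certificate (bookkeeping)] -/
theorem pevalR_absList_mono (cs : List ℚ) {Y Z : ℝ} (hY : 0 ≤ Y) (hYZ : Y ≤ Z) :
    pevalR (absList cs) Y ≤ pevalR (absList cs) Z := by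
  induction cs with
  | nil => simp [pevalR, absList]
  | cons c cs ih =>
    simp only [pevalR, absList, List.map] at ih ⊢
    have h0 : 0 ≤ pevalR (List.map (fun c => |c|) cs) Z := pevalR_absList_nonneg cs (hY.trans hYZ)
    exact add_le_add le_rfl (mul_le_mul hYZ ih (pevalR_absList_nonneg cs hY) (hY.trans hYZ))

/-- `y_n = (n+1)²·y_0`.
[cite: CsordasNorfolkVarga1986, the concavity of log Φ(√t) (= DimitrovLucas2011, Theorem B); kernel interval-arithmetic certificate (bookkeeping)] -/
theorem thetaFreq_eq_mul_zero (x : ℝ) (n : ℕ) : thetaFreq x n = ((n : ℝ) + 1) ^ 2 * thetaFreq x 0 := by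
  simp only [thetaFreq, Nat.cast_zero, zero_add, one_pow, mul_one]; ring

/-- `y_n ≥ 0` for `x ≥ 0`.
[cite: CsordasNorfolkVarga1986, the concavity of log Φ(√t) (= DimitrovLucas2011, Theorem B); kernel interval-arithmetic certificate (bookkeeping)] -/
theorem thetaFreq_nonneg {x : ℝ} (hx : 0 ≤ x) (n : ℕ) : 0 ≤ thetaFreq x n := by
  unfold thetaFreq; positivity

/-- Summability of `n ↦ y_n^k · P(y_n) · e^{−y_n}` for `x > 0`.
[cite: CsordasNorfolkVarga1986, the concavity of log Φ(√t) (= DimitrovLucas2011, Theorem B); kernel interval-arithmetic certificate (bookkeeping)] -/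
theorem summable_pow_mul_qterm (cs : List ℚ) {x : ℝ} (hx : 0 < x) (k : ℕ) :
    Summable fun n => thetaFreq x n ^ k * (pevalR cs (thetaFreq x n) * Real.exp (-thetaFreq x n)) := by
  induction cs generalizing k with
  | nil => simp only [pevalR, zero_mul, mul_zero]; exact summable_zero
  | cons c cs ih =>
    have h1 : Summable fun n => (c : ℝ) * (x ^ k * thetaMomentTerm k x n) :=
      ((summable_thetaMomentTerm k hx).mul_left _).mul_left _
    refine (h1.add (ih (k + 1))).congr fun n => ?_
    rw [pow_mul_thetaMomentTerm]
    simp only [pevalR]; ring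

/-- Summability of the series `∑_n P(y_n)e^{−y_n}`.
[cite: CsordasNorfolkVarga1986, the concavity of log Φ(√t) (= DimitrovLucas2011, Theorem B); kernel interval-arithmetic certificate (bookkeeping)] -/
theorem summable_qterm (cs : List ℚ) {x : ℝ} (hx : 0 < x) : Summable (qterm cs x) :=
  (summable_pow_mul_qterm cs hx 0).congr fun n => by simp [qterm]

/-! ## 6. The tail `n ≥ 2`: `∑_{n≥2} |P|(y_n) e^{−y_n} ≤ (1 + 2·10⁻⁶)·|P|(9y_0)·e^{−9y_0}` (degree ≤ 6, `y_0 ≥ 3`) -/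

/-- The tail constant `1 + 2·10⁻⁶ ≥ 1/(1 − e^{−14})`.
[cite: CsordasNorfolkVarga1986, the concavity of log Φ(√t) (= DimitrovLucas2011, Theorem B); kernel interval-arithmetic certificate (bookkeeping)] -/
def tailC : ℚ := 500001 / 500000

/-- `e^{−14} ≤ 10⁻⁶`.
[cite: CsordasNorfolkVarga1986, the concavity of log Φ(√t) (= DimitrovLucas2011, Theorem B); kernel interval-arithmetic certificate (bookkeeping)] -/
theorem exp_neg_fourteen_le : Real.exp (-14) ≤ 1 / 1000000 := by
  have h1 : Real.exp 1 > 2.7 := lt_trans (by norm_num) Real.exp_one_gt_d9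
  have h14 : Real.exp 14 = Real.exp 1 ^ 14 := by rw [← Real.exp_nat_mul]; norm_num
  have h2 : (1000000 : ℝ) ≤ Real.exp 14 := by
    rw [h14]; exact le_trans (by norm_num) (pow_le_pow_left₀ (by norm_num) h1.le 14)
  rw [Real.exp_neg, inv_eq_one_div]
  exact one_div_le_one_div_of_le (by norm_num) h2

/-- One monomial of the tail: for `y_0 ≥ 3`, `k ≤ 6`:
`y_{n+2}^k e^{−y_{n+2}} ≤ (9y_0)^k e^{−9y_0} · (e^{−14})^n`.
[cite: CsordasNorfolkVarga1986, the concavity of log Φ(√t) (= DimitrovLucas2011, Theorem B); kernel interval-arithmetic certificate (bookkeeping)] -/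
theorem tail_term_le {x : ℝ} (hy : 3 ≤ thetaFreq x 0) {k : ℕ} (hk : k ≤ 6) (n : ℕ) :
    thetaFreq x (n + 2) ^ k * Real.exp (-thetaFreq x (n + 2)) ≤
      (9 * thetaFreq x 0) ^ k * Real.exp (-(9 * thetaFreq x 0)) * Real.exp (-14) ^ n := by
  set y := thetaFreq x 0 with hy0
  have hypos : 0 < y := by linarith
  -- `y_{n+2} = r · 9y` with `r = (n+3)²/9 ≥ 1`, `r − 1 ≥ 2n/3`
  set r : ℝ := ((n : ℝ) + 3) ^ 2 / 9 with hr
  have hr1 : 1 ≤ r := by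
    rw [hr, le_div_iff₀ (by norm_num)]; nlinarith [(n.cast_nonneg : (0 : ℝ) ≤ n)]
  have hrn : 2 * (n : ℝ) / 3 ≤ r - 1 := by
    rw [hr]; nlinarith [(n.cast_nonneg : (0 : ℝ) ≤ n)]
  have hYeq : thetaFreq x (n + 2) = r * (9 * y) := by
    rw [thetaFreq_eq_mul_zero x (n + 2), hr]; push_cast; ring
  have h9y : 0 < 9 * y := by linarith
  -- `r^k ≤ e^{6(r−1)}`
  have hrexp : r ≤ Real.exp (r - 1) := by linarith [Real.add_one_le_exp (r - 1)]
  have hr0 : 0 ≤ r := le_trans zero_le_one hr1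
  have hrk : r ^ k ≤ Real.exp (6 * (r - 1)) := by
    calc r ^ k ≤ r ^ 6 := pow_le_pow_right₀ hr1 hk
      _ ≤ Real.exp (r - 1) ^ 6 := pow_le_pow_left₀ hr0 hrexp 6
      _ = Real.exp (6 * (r - 1)) := by rw [← Real.exp_nat_mul]; norm_num
  -- assemble
  rw [hYeq, mul_pow]
  have hexp : Real.exp (-(r * (9 * y))) = Real.exp (-(9 * y)) * Real.exp (-((r - 1) * (9 * y))) := by
    rw [← Real.exp_add]; congr 1; ring
  rw [hexp]
  have hdecay : Real.exp (6 * (r - 1)) * Real.exp (-((r - 1) * (9 * y))) ≤ Real.exp (-14) ^ n := by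
    rw [← Real.exp_add, ← Real.exp_nat_mul]
    apply Real.exp_le_exp.2
    have h27 : 27 * (r - 1) ≤ (r - 1) * (9 * y) := by nlinarith
    nlinarith
  have hpos1 : 0 ≤ (9 * y) ^ k * Real.exp (-(9 * y)) := by positivity
  calc r ^ k * (9 * y) ^ k * (Real.exp (-(9 * y)) * Real.exp (-((r - 1) * (9 * y))))
      = (9 * y) ^ k * Real.exp (-(9 * y)) * (r ^ k * Real.exp (-((r - 1) * (9 * y)))) := by ring
    _ ≤ (9 * y) ^ k * Real.exp (-(9 * y)) * (Real.exp (6 * (r - 1)) * Real.exp (-((r - 1) * (9 * y)))) := by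
        gcongr
    _ ≤ (9 * y) ^ k * Real.exp (-(9 * y)) * Real.exp (-14) ^ n := by gcongr

/-- The monomial tail sum: `∑_n y_{n+2}^k e^{−y_{n+2}} ≤ tailC·(9y_0)^k e^{−9y_0}` (`k ≤ 6`, `y_0 ≥ 3`).
[cite: CsordasNorfolkVarga1986, the concavity of log Φ(√t) (= DimitrovLucas2011, Theorem B); kernel interval-arithmetic certificate (bookkeeping)] -/
theorem tsum_tail_pow_le {x : ℝ} (hx : 0 < x) (hy : 3 ≤ thetaFreq x 0) {k : ℕ} (hk : k ≤ 6) :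
    ∑' n, thetaFreq x (n + 2) ^ k * Real.exp (-thetaFreq x (n + 2)) ≤
      (tailC : ℝ) * ((9 * thetaFreq x 0) ^ k * Real.exp (-(9 * thetaFreq x 0))) := by
  set A := (9 * thetaFreq x 0) ^ k * Real.exp (-(9 * thetaFreq x 0)) with hA
  have hA0 : 0 ≤ A := by positivity
  have hq0 : 0 ≤ Real.exp (-14) := (Real.exp_pos _).le
  have hq1 : Real.exp (-14) < 1 := by linarith [exp_neg_fourteen_le]
  have hgeom : Summable fun n : ℕ => A * Real.exp (-14) ^ n := (summable_geometric_of_lt_one hq0 hq1).mul_left A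
  have hle : ∀ n, thetaFreq x (n + 2) ^ k * Real.exp (-thetaFreq x (n + 2)) ≤ A * Real.exp (-14) ^ n :=
    fun n => tail_term_le hy hk n
  have hnn : ∀ n, 0 ≤ thetaFreq x (n + 2) ^ k * Real.exp (-thetaFreq x (n + 2)) := fun n => by
    have := thetaFreq_nonneg hx.le (n + 2); positivity
  have hsum : Summable fun n => thetaFreq x (n + 2) ^ k * Real.exp (-thetaFreq x (n + 2)) :=
    Summable.of_nonneg_of_le hnn hle hgeom
  calc ∑' n, thetaFreq x (n + 2) ^ k * Real.exp (-thetaFreq x (n + 2))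
      ≤ ∑' n : ℕ, A * Real.exp (-14) ^ n := hsum.tsum_le_tsum hle hgeom
    _ = A * (1 - Real.exp (-14))⁻¹ := by rw [tsum_mul_left, tsum_geometric_of_lt_one hq0 hq1]
    _ ≤ A * (tailC : ℝ) := by
        apply mul_le_mul_of_nonneg_left _ hA0
        rw [inv_le_comm₀ (by linarith) (by norm_num [tailC]), tailC]
        push_cast
        linarith [exp_neg_fourteen_le]
    _ = (tailC : ℝ) * A := mul_comm _ _

/-- The polynomial tail: for `|P|` (nonnegative coefficients `absList cs`), degree `k + |cs| ≤ 7`, `y_0 ≥ 3`: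
`∑_n y_{n+2}^k |P|(y_{n+2}) e^{−y_{n+2}} ≤ tailC · (9y_0)^k |P|(9y_0) e^{−9y_0}`.
[cite: CsordasNorfolkVarga1986, the concavity of log Φ(√t) (= DimitrovLucas2011, Theorem B); kernel interval-arithmetic certificate (bookkeeping)] -/
theorem tsum_tail_poly_le (cs : List ℚ) {x : ℝ} (hx : 0 < x) (hy : 3 ≤ thetaFreq x 0) (k : ℕ)
    (hk : k + cs.length ≤ 7) :
    ∑' n, thetaFreq x (n + 2) ^ k * (pevalR (absList cs) (thetaFreq x (n + 2)) * Real.exp (-thetaFreq x (n + 2))) ≤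
      (tailC : ℝ) * ((9 * thetaFreq x 0) ^ k * pevalR (absList cs) (9 * thetaFreq x 0) *
        Real.exp (-(9 * thetaFreq x 0))) := by
  induction cs generalizing k with
  | nil => simp [pevalR, absList]
  | cons c cs ih =>
    simp only [List.length_cons] at hk
    have hk6 : k ≤ 6 := by omega
    have hsplit : ∀ n, thetaFreq x (n + 2) ^ k * (pevalR (absList (c :: cs)) (thetaFreq x (n + 2)) *
        Real.exp (-thetaFreq x (n + 2))) =
        ((|c| : ℚ) : ℝ) * (thetaFreq x (n + 2) ^ k * Real.exp (-thetaFreq x (n + 2))) +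
        thetaFreq x (n + 2) ^ (k + 1) * (pevalR (absList cs) (thetaFreq x (n + 2)) *
          Real.exp (-thetaFreq x (n + 2))) := fun n => by
      simp only [absList, List.map, pevalR]; ring
    have hs1 : Summable fun n => thetaFreq x (n + 2) ^ k * Real.exp (-thetaFreq x (n + 2)) := by
      have h := (summable_nat_add_iff 2).mpr (summable_pow_mul_qterm [1] hx k)
      refine h.congr fun n => ?_
      simp [pevalR]
    have hs2 : Summable fun n => thetaFreq x (n + 2) ^ (k + 1) * (pevalR (absList cs) (thetaFreq x (n + 2)) *
        Real.exp (-thetaFreq x (n + 2))) :=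
      (summable_nat_add_iff 2).mpr (summable_pow_mul_qterm (absList cs) hx (k + 1))
    rw [tsum_congr hsplit, (hs1.mul_left _).tsum_add hs2, tsum_mul_left]
    have hb1 := tsum_tail_pow_le hx hy hk6
    have hb2 := ih (k + 1) (by omega)
    have hc0 : (0 : ℝ) ≤ ((|c| : ℚ) : ℝ) := by exact_mod_cast abs_nonneg c
    have e : (tailC : ℝ) * ((9 * thetaFreq x 0) ^ k * pevalR (absList (c :: cs)) (9 * thetaFreq x 0) *
        Real.exp (-(9 * thetaFreq x 0))) =
        ((|c| : ℚ) : ℝ) * ((tailC : ℝ) * ((9 * thetaFreq x 0) ^ k * Real.exp (-(9 * thetaFreq x 0)))) +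
        (tailC : ℝ) * ((9 * thetaFreq x 0) ^ (k + 1) * pevalR (absList cs) (9 * thetaFreq x 0) *
          Real.exp (-(9 * thetaFreq x 0))) := by
      simp only [absList, List.map, pevalR]; ring
    rw [e]
    exact add_le_add (mul_le_mul_of_nonneg_left hb1 hc0) hb2

/-- **The tail bound**: `|∑_{n} P(y_{n+2})e^{−y_{n+2}}| ≤ tailC·|P|(9y_0)·e^{−9y_0}` for `|cs| ≤ 7`, `y_0 ≥ 3`.
[cite: CsordasNorfolkVarga1986, the concavity of log Φ(√t) (= DimitrovLucas2011, Theorem B); kernel interval-arithmetic certificate (bookkeeping)] -/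
theorem abs_tsum_qterm_tail_le (cs : List ℚ) (hlen : cs.length ≤ 7) {x : ℝ} (hx : 0 < x)
    (hy : 3 ≤ thetaFreq x 0) :
    |∑' n, qterm cs x (n + 2)| ≤
      (tailC : ℝ) * (pevalR (absList cs) (9 * thetaFreq x 0) * Real.exp (-(9 * thetaFreq x 0))) := by
  have hmain := tsum_tail_poly_le cs hx hy 0 (by simpa using hlen)
  simp only [pow_zero, one_mul] at hmain
  have hs : Summable fun n => qterm cs x (n + 2) := (summable_nat_add_iff 2).mpr (summable_qterm cs hx)
  have hsabs : Summable fun n => pevalR (absList cs) (thetaFreq x (n + 2)) * Real.exp (-thetaFreq x (n + 2)) := by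
    have h := (summable_nat_add_iff 2).mpr (summable_pow_mul_qterm (absList cs) hx 0)
    simpa using h
  have hterm : ∀ n, |qterm cs x (n + 2)| ≤
      pevalR (absList cs) (thetaFreq x (n + 2)) * Real.exp (-thetaFreq x (n + 2)) := fun n => by
    unfold qterm
    rw [abs_mul, abs_of_pos (Real.exp_pos _)]
    exact mul_le_mul_of_nonneg_right (abs_pevalR_le cs (thetaFreq_nonneg hx.le _)) (Real.exp_pos _).le
  have h1 : ∑' n, qterm cs x (n + 2) ≤ ∑' n, pevalR (absList cs) (thetaFreq x (n + 2)) *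
      Real.exp (-thetaFreq x (n + 2)) := hs.tsum_le_tsum (fun n => (abs_le.mp (hterm n)).2) hsabs
  have h2 : ∑' n, -(pevalR (absList cs) (thetaFreq x (n + 2)) * Real.exp (-thetaFreq x (n + 2))) ≤
      ∑' n, qterm cs x (n + 2) := hsabs.neg.tsum_le_tsum (fun n => (abs_le.mp (hterm n)).1) hs
  rw [tsum_neg] at h2
  exact abs_le.mpr ⟨by linarith, by linarith⟩

/-! ## 7. The cell enclosure of `e^{y_0}·∑_n P(y_n)e^{−y_n}` -/

/-- **Cell enclosure** of `e^{y_0} ∑_n P(y_n)e^{−y_n} = P(y_0) + P(4y_0)e^{−3y_0} + e^{y_0}·(tail)` for `y_0 ∈ [a, a+h]`: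
Taylor ranges of `P(y)` and `P(4y)`, `e^{−3y_0} ∈ [e^{−3(a+h)}, e^{−3a}]`, tail widened by
`tailC·|P|(9(a+h))·e^{−8a}`.
[cite: CsordasNorfolkVarga1986, the concavity of log Φ(√t) (= DimitrovLucas2011, Theorem B); kernel interval-arithmetic certificate (bookkeeping)] -/
def cellIv (cs : List ℚ) (a h : ℚ) : Iv :=
  let A := prangeAt cs a h
  let B := prangeAt (scale4 cs) a h
  let E3 : Iv := ((expNegIv (3 * (a + h))).1, (expNegIv (3 * a)).2)
  let r := ceilG (tailC * pevalQ (absList cs) (9 * (a + h)) * (expNegIv (8 * a)).2)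
  ivWiden (ivAdd A (ivMul B E3)) r

/-- **Soundness of the cell enclosure.**
[cite: CsordasNorfolkVarga1986, the concavity of log Φ(√t) (= DimitrovLucas2011, Theorem B); kernel interval-arithmetic certificate (bookkeeping)] -/
theorem mem_cellIv (cs : List ℚ) (hlen : cs.length ≤ 7) {a h : ℚ} (ha : 3 ≤ a) {x : ℝ} (hx : 0 < x)
    (h1 : (a : ℝ) ≤ thetaFreq x 0) (h2 : thetaFreq x 0 ≤ (a : ℝ) + h) :
    Mem (Real.exp (thetaFreq x 0) * ∑' n, qterm cs x n) (cellIv cs a h) := by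
  have hy3 : 3 ≤ thetaFreq x 0 := le_trans (by exact_mod_cast ha) h1
  have hhR : (0 : ℝ) ≤ (h : ℝ) := by linarith
  have hh : (0 : ℚ) ≤ h := by exact_mod_cast hhR
  -- split off `n = 0, 1`
  have hs := summable_qterm cs hx
  have hs1 : Summable fun n => qterm cs x (n + 1) := (summable_nat_add_iff 1).mpr hs
  have e1 : thetaFreq x 1 = 4 * thetaFreq x 0 := by rw [thetaFreq_eq_mul_zero x 1]; norm_num
  have ex1 : Real.exp (thetaFreq x 0) * Real.exp (-thetaFreq x 0) = 1 := by rw [← Real.exp_add]; simp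
  have ex2 : Real.exp (thetaFreq x 0) * Real.exp (-(4 * thetaFreq x 0)) = Real.exp (-(3 * thetaFreq x 0)) := by
    rw [← Real.exp_add]; congr 1; ring
  have hsplit : Real.exp (thetaFreq x 0) * ∑' n, qterm cs x n =
      (pevalR cs (thetaFreq x 0) + pevalR (scale4 cs) (thetaFreq x 0) * Real.exp (-(3 * thetaFreq x 0))) +
        Real.exp (thetaFreq x 0) * ∑' n, qterm cs x (n + 2) := by
    rw [hs.tsum_eq_zero_add, hs1.tsum_eq_zero_add]
    have et : (∑' n, qterm cs x (n + 1 + 1)) = ∑' n, qterm cs x (n + 2) := rfl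
    rw [et, zero_add, pevalR_scale4]
    unfold qterm
    rw [e1]
    calc Real.exp (thetaFreq x 0) * (pevalR cs (thetaFreq x 0) * Real.exp (-thetaFreq x 0) +
          (pevalR cs (4 * thetaFreq x 0) * Real.exp (-(4 * thetaFreq x 0)) +
          ∑' n, pevalR cs (thetaFreq x (n + 2)) * Real.exp (-thetaFreq x (n + 2))))
        = pevalR cs (thetaFreq x 0) * (Real.exp (thetaFreq x 0) * Real.exp (-thetaFreq x 0)) +
          pevalR cs (4 * thetaFreq x 0) * (Real.exp (thetaFreq x 0) * Real.exp (-(4 * thetaFreq x 0))) +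
          Real.exp (thetaFreq x 0) * ∑' n, pevalR cs (thetaFreq x (n + 2)) * Real.exp (-thetaFreq x (n + 2)) := by
          ring
      _ = _ := by rw [ex1, ex2, mul_one]
  rw [hsplit]
  unfold cellIv
  apply mem_ivWiden
  · apply mem_ivAdd (mem_prangeAt cs h1 h2)
    apply mem_ivMul (mem_prangeAt (scale4 cs) h1 h2)
    constructor
    · have hm := (mem_expNegIv (x := 3 * (a + h)) (by linarith)).1
      refine le_trans hm (Real.exp_le_exp.2 ?_); push_cast; linarith
    · have hm := (mem_expNegIv (x := 3 * a) (by linarith)).2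
      refine le_trans (Real.exp_le_exp.2 ?_) hm; push_cast; linarith
  · -- the tail
    have ht := abs_tsum_qterm_tail_le cs hlen hx hy3
    apply real_le_ceilG
    rw [abs_mul, abs_of_pos (Real.exp_pos _)]
    have hexp8 : Real.exp (thetaFreq x 0) * Real.exp (-(9 * thetaFreq x 0)) = Real.exp (-(8 * thetaFreq x 0)) := by
      rw [← Real.exp_add]; congr 1; ring
    have hm8 := (mem_expNegIv (x := 8 * a) (by linarith)).2
    have he8 : Real.exp (-(8 * thetaFreq x 0)) ≤ ((expNegIv (8 * a)).2 : ℝ) := by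
      calc Real.exp (-(8 * thetaFreq x 0)) ≤ Real.exp (-((8 * a : ℚ) : ℝ)) :=
            Real.exp_le_exp.2 (by push_cast; linarith)
        _ ≤ _ := hm8
    have hP : pevalR (absList cs) (9 * thetaFreq x 0) ≤ ((pevalQ (absList cs) (9 * (a + h)) : ℚ) : ℝ) := by
      rw [← pevalR_ratCast]; push_cast
      exact pevalR_absList_mono cs (by linarith) (by linarith)
    have hP0 : 0 ≤ pevalR (absList cs) (9 * thetaFreq x 0) := pevalR_absList_nonneg cs (by linarith)
    have htC : (0 : ℝ) ≤ tailC := by norm_num [tailC]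
    calc Real.exp (thetaFreq x 0) * |∑' n, qterm cs x (n + 2)|
        ≤ Real.exp (thetaFreq x 0) * ((tailC : ℝ) * (pevalR (absList cs) (9 * thetaFreq x 0) *
            Real.exp (-(9 * thetaFreq x 0)))) := mul_le_mul_of_nonneg_left ht (Real.exp_pos _).le
      _ = (tailC : ℝ) * pevalR (absList cs) (9 * thetaFreq x 0) *
            (Real.exp (thetaFreq x 0) * Real.exp (-(9 * thetaFreq x 0))) := by ring
      _ = (tailC : ℝ) * pevalR (absList cs) (9 * thetaFreq x 0) * Real.exp (-(8 * thetaFreq x 0)) := by rw [hexp8]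
      _ ≤ (tailC : ℝ) * ((pevalQ (absList cs) (9 * (a + h)) : ℚ) : ℝ) * ((expNegIv (8 * a)).2 : ℝ) :=
          mul_le_mul (mul_le_mul_of_nonneg_left hP htC) he8 (Real.exp_pos _).le
            (mul_nonneg htC (hP0.trans hP))
      _ = _ := by push_cast; ring

end Literature.NumberTheory.LFunctions.DeBruijnPhiCells.CoeffTable

end Part3

/-!
## Part 4 — port of `Summits/RiemannHypothesis/RiemannHypothesis/Theorems/JensenPolynomialsPhiCellForms.lean` (16 declarations kept)

# Route `JensenPolynomials`, item `XiDeltaSqPos` (S-T5) — toolbox 4: the three cell checks and their soundness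
(RH-FREE; cell rh-jensen, HUMAN RULING D-0040)

Fourth piece of the kernel certificate for the crux `XiDeltaSqPos` (Csordas–Varga 1988, Theorem 2.2). With
`F_m = ∑_n P_m(y_n)e^{−y_n}` (`phiSeries m`, `P₀, …, P₄` the polynomials of `Φ, Φ′, Φ″, Φ‴, Φ⁗`, so that
`Φ^{(m)}(u) = eᵘF_m(e^{4u})`), the monotonicity of `−Φ′(u)/(uΦ(u))` on `(0, 1/4]` reduces to the positivity of three
forms on three ranges of `y₀ = πe^{4u}`:

* regime A (`u` near `0`, where `T = −Φ²Φ‴ + 3ΦΦ′Φ″ − 2Φ′³` vanishes at `0`): `T′e^{−3u} = −F₀²F₄ + F₀F₁F₃ + 3F₀F₂² − 3F₁²F₂ > 0`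
  (`checkA`, `formA_pos_of_checkA`);
* regime T: `Te^{−3u} = −F₀²F₃ + 3F₀F₁F₂ − 2F₁³ > 0` (`checkT`, `formT_pos_of_checkT`), i.e. `V′Φ³ > 0` with
  `V = −(log Φ)″`;
* regime N: `Ne^{−2u} = u(F₁² − F₀F₂) + F₀F₁ > 0` (`checkN`, `formN_pos_of_checkN`), i.e. `(L/u)′u²Φ² > 0`, the cell
  carrying a certified `u_lo ≤ u` (`π·e^{4u_lo} ≤ a` via `expPosHi` and `Real.pi_lt_d20`).

Each check evaluates the form in exact-ℚ interval arithmetic on the cell enclosures of toolbox 3 (`decide` in the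
kernel, next file) and the soundness theorems turn a `true` into the real inequality on the whole cell; `*_of_all`
combine a covering list of checked cells. WHAT THIS IS NOT: nothing here bears on the zeros of `ζ`.
References: Csordas–Varga 1988, Thm 2.2 [CsordasVarga1988]; Varga 1990 §3.3 [Varga1990].

(Verbatim declaration-level port — the declarations listed in the Part header count — of the Summits-side module of the
RiemannHypothesis tree's Jensen-polynomial cell; cell / rung / item bookkeeping in the text above is historical.)
-/

section Part4

namespace Literature.NumberTheory.LFunctions.DeBruijnPhiCells.CoeffTable

open _root_.Finset Literature.NumberTheory.LFunctions
open scoped _root_.BigOperators _root_.Nat _root_.Real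

/-! ## 8. The five polynomials `P₀, …, P₄` of `Φ, Φ′, Φ″, Φ‴, Φ⁗`, their series, and the three forms -/

/-- Coefficient lists of `P₀(y) = 2y² − 3y`, `P₁ = −8y³ + 30y² − 15y`, `P₂ = 32y⁴ − 224y³ + 330y² − 75y`,
`P₃ = −128y⁵ + 1440y⁴ − 4232y³ + 3270y² − 375y`, `P₄ = 512y⁶ − 8448y⁵ + 41408y⁴ − 68096y³ + 30930y² − 1875y`
(`Φ^{(m)}(u) = eᵘ ∑_n P_m(y_n)e^{−y_n}`; index `≥ 4` returns `P₄`).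
[cite: CsordasNorfolkVarga1986, the concavity of log Φ(√t) (= DimitrovLucas2011, Theorem B); kernel interval-arithmetic certificate (bookkeeping)] -/
def Qc : ℕ → List ℚ
  | 0 => [0, -3, 2]
  | 1 => [0, -15, 30, -8]
  | 2 => [0, -75, 330, -224, 32]
  | 3 => [0, -375, 3270, -4232, 1440, -128]
  | _ => [0, -1875, 30930, -68096, 41408, -8448, 512]

/-- All five lists have length `≤ 7`.
[cite: CsordasNorfolkVarga1986, the concavity of log Φ(√t) (= DimitrovLucas2011, Theorem B); kernel interval-arithmetic certificate (bookkeeping)] -/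
theorem Qc_length (m : ℕ) : (Qc m).length ≤ 7 := by
  rcases m with _ | _ | _ | _ | _ <;> simp [Qc]

/-- The series `F_m(x) = ∑_n P_m(y_n)e^{−y_n}` (so that `Φ^{(m)}(u) = eᵘ F_m(e^{4u})`).
[cite: CsordasNorfolkVarga1986, the concavity of log Φ(√t) (= DimitrovLucas2011, Theorem B); kernel interval-arithmetic certificate (bookkeeping)] -/
noncomputable def phiSeries (m : ℕ) (x : ℝ) : ℝ := ∑' n, qterm (Qc m) x n

/-- Interval of the form `−S₀²S₄ + S₀S₁S₃ + 3S₀S₂² − 3S₁²S₂` (sign of `T′ = (V′Φ³)′`) on the cell `[a, a+h]`.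
[cite: CsordasNorfolkVarga1986, the concavity of log Φ(√t) (= DimitrovLucas2011, Theorem B); kernel interval-arithmetic certificate (bookkeeping)] -/
def formAIv (a h : ℚ) : Iv :=
  let I0 := cellIv (Qc 0) a h
  let I1 := cellIv (Qc 1) a h
  let I2 := cellIv (Qc 2) a h
  let I3 := cellIv (Qc 3) a h
  let I4 := cellIv (Qc 4) a h
  ivAdd (ivAdd (ivNeg (ivMul (ivMul I0 I0) I4)) (ivMul (ivMul I0 I1) I3))
    (ivAdd (ivScale 3 (ivMul I0 (ivMul I2 I2))) (ivScale (-3) (ivMul (ivMul I1 I1) I2)))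

/-- Interval of the form `−S₀²S₃ + 3S₀S₁S₂ − 2S₁³` (sign of `T = V′Φ³`) on the cell `[a, a+h]`.
[cite: CsordasNorfolkVarga1986, the concavity of log Φ(√t) (= DimitrovLucas2011, Theorem B); kernel interval-arithmetic certificate (bookkeeping)] -/
def formTIv (a h : ℚ) : Iv :=
  let I0 := cellIv (Qc 0) a h
  let I1 := cellIv (Qc 1) a h
  let I2 := cellIv (Qc 2) a h
  let I3 := cellIv (Qc 3) a h
  ivAdd (ivAdd (ivNeg (ivMul (ivMul I0 I0) I3)) (ivScale 3 (ivMul (ivMul I0 I1) I2)))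
    (ivScale (-2) (ivMul (ivMul I1 I1) I1))

/-- Cell check, regime A (`T′ > 0`): `a ≥ 3` and the form interval has positive lower end.
[cite: CsordasNorfolkVarga1986, the concavity of log Φ(√t) (= DimitrovLucas2011, Theorem B); kernel interval-arithmetic certificate (bookkeeping)] -/
def checkA (c : ℚ × ℚ) : Bool := decide (3 ≤ c.1) && decide (0 < (formAIv c.1 c.2).1)

/-- Cell check, regime T (`T > 0`).
[cite: CsordasNorfolkVarga1986, the concavity of log Φ(√t) (= DimitrovLucas2011, Theorem B); kernel interval-arithmetic certificate (bookkeeping)] -/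
def checkT (c : ℚ × ℚ) : Bool := decide (3 ≤ c.1) && decide (0 < (formTIv c.1 c.2).1)

/-- A rational upper bound of `π` (`Real.pi_lt_d20`).
[cite: CsordasNorfolkVarga1986, the concavity of log Φ(√t) (= DimitrovLucas2011, Theorem B); kernel interval-arithmetic certificate (bookkeeping)] -/
def piHi : ℚ := 3.14159265358979323847

/-- Cell check, regime N (`N = u(Φ′² − ΦΦ″) + ΦΦ′ > 0` with `u ≥ u_lo`): the cell carries `u_lo` with
`π·e^{4u_lo} ≤ a` (certified by `expPosHi`), `S₁² − S₀S₂` has positive lower end `p`, and `u_lo·p + (S₀S₁).lo > 0`.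
[cite: CsordasNorfolkVarga1986, the concavity of log Φ(√t) (= DimitrovLucas2011, Theorem B); kernel interval-arithmetic certificate (bookkeeping)] -/
def checkN (c : ℚ × ℚ × ℚ) : Bool :=
  let a := c.1
  let h := c.2.1
  let ul := c.2.2
  let I0 := cellIv (Qc 0) a h
  let I1 := cellIv (Qc 1) a h
  let I2 := cellIv (Qc 2) a h
  let P := ivAdd (ivMul I1 I1) (ivNeg (ivMul I0 I2))
  decide (3 ≤ a) && decide (0 ≤ ul) && decide (4 * ul ≤ 1) && decide (piHi * expPosHi (4 * ul) ≤ a) &&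
    decide (0 < P.1) && decide (0 < ul * P.1 + (ivMul I0 I1).1)

/-- `e^{y_0}·F_m(x)` lies in the cell interval of `P_m`.
[cite: CsordasNorfolkVarga1986, the concavity of log Φ(√t) (= DimitrovLucas2011, Theorem B); kernel interval-arithmetic certificate (bookkeeping)] -/
theorem mem_cellIv_phiSeries (m : ℕ) {a h : ℚ} (ha : 3 ≤ a) {x : ℝ} (hx : 0 < x)
    (h1 : (a : ℝ) ≤ thetaFreq x 0) (h2 : thetaFreq x 0 ≤ (a : ℝ) + h) :
    Mem (Real.exp (thetaFreq x 0) * phiSeries m x) (cellIv (Qc m) a h) :=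
  mem_cellIv (Qc m) (Qc_length m) ha hx h1 h2

/-- **Regime A soundness**: `checkA (a, h)` certifies `−F₀²F₄ + F₀F₁F₃ + 3F₀F₂² − 3F₁²F₂ > 0` at every `x > 0`
with `y_0 = πx ∈ [a, a + h]`.
[cite: CsordasNorfolkVarga1986, the concavity of log Φ(√t) (= DimitrovLucas2011, Theorem B); kernel interval-arithmetic certificate (bookkeeping)] -/
theorem formA_pos_of_checkA {a h : ℚ} (hc : checkA (a, h) = true) {x : ℝ} (hx : 0 < x)
    (h1 : (a : ℝ) ≤ thetaFreq x 0) (h2 : thetaFreq x 0 ≤ (a : ℝ) + h) :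
    0 < -(phiSeries 0 x ^ 2 * phiSeries 4 x) + phiSeries 0 x * phiSeries 1 x * phiSeries 3 x +
      3 * phiSeries 0 x * phiSeries 2 x ^ 2 - 3 * phiSeries 1 x ^ 2 * phiSeries 2 x := by
  simp only [checkA, Bool.and_eq_true, decide_eq_true_eq] at hc
  obtain ⟨ha, hpos⟩ := hc
  have hm := fun m => mem_cellIv_phiSeries m ha hx h1 h2
  set E := Real.exp (thetaFreq x 0) with hE
  have hE0 : 0 < E := Real.exp_pos _
  have key : Mem (-(E * phiSeries 0 x * (E * phiSeries 0 x) * (E * phiSeries 4 x)) +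
      E * phiSeries 0 x * (E * phiSeries 1 x) * (E * phiSeries 3 x) +
      (((3 : ℚ) : ℝ) * (E * phiSeries 0 x * (E * phiSeries 2 x * (E * phiSeries 2 x))) +
       ((-3 : ℚ) : ℝ) * (E * phiSeries 1 x * (E * phiSeries 1 x) * (E * phiSeries 2 x)))) (formAIv a h) := by
    unfold formAIv
    exact mem_ivAdd (mem_ivAdd (mem_ivNeg (mem_ivMul (mem_ivMul (hm 0) (hm 0)) (hm 4)))
      (mem_ivMul (mem_ivMul (hm 0) (hm 1)) (hm 3)))
      (mem_ivAdd (mem_ivScale 3 (mem_ivMul (hm 0) (mem_ivMul (hm 2) (hm 2))))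
        (mem_ivScale (-3) (mem_ivMul (mem_ivMul (hm 1) (hm 1)) (hm 2))))
  have hposR := pos_of_mem key hpos
  have e : -(E * phiSeries 0 x * (E * phiSeries 0 x) * (E * phiSeries 4 x)) +
      E * phiSeries 0 x * (E * phiSeries 1 x) * (E * phiSeries 3 x) +
      (((3 : ℚ) : ℝ) * (E * phiSeries 0 x * (E * phiSeries 2 x * (E * phiSeries 2 x))) +
       ((-3 : ℚ) : ℝ) * (E * phiSeries 1 x * (E * phiSeries 1 x) * (E * phiSeries 2 x))) =
      E ^ 3 * (-(phiSeries 0 x ^ 2 * phiSeries 4 x) + phiSeries 0 x * phiSeries 1 x * phiSeries 3 x +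
      3 * phiSeries 0 x * phiSeries 2 x ^ 2 - 3 * phiSeries 1 x ^ 2 * phiSeries 2 x) := by
    push_cast; ring
  rw [e] at hposR
  rcases (mul_pos_iff.mp hposR) with ⟨_, h2⟩ | ⟨h1, _⟩
  · exact h2
  · exact absurd h1 (not_lt.mpr (pow_pos hE0 3).le)

/-- **Regime T soundness**: `checkT (a, h)` certifies `−F₀²F₃ + 3F₀F₁F₂ − 2F₁³ > 0`.
[cite: CsordasNorfolkVarga1986, the concavity of log Φ(√t) (= DimitrovLucas2011, Theorem B); kernel interval-arithmetic certificate (bookkeeping)] -/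
theorem formT_pos_of_checkT {a h : ℚ} (hc : checkT (a, h) = true) {x : ℝ} (hx : 0 < x)
    (h1 : (a : ℝ) ≤ thetaFreq x 0) (h2 : thetaFreq x 0 ≤ (a : ℝ) + h) :
    0 < -(phiSeries 0 x ^ 2 * phiSeries 3 x) + 3 * phiSeries 0 x * phiSeries 1 x * phiSeries 2 x -
      2 * phiSeries 1 x ^ 3 := by
  simp only [checkT, Bool.and_eq_true, decide_eq_true_eq] at hc
  obtain ⟨ha, hpos⟩ := hc
  have hm := fun m => mem_cellIv_phiSeries m ha hx h1 h2
  set E := Real.exp (thetaFreq x 0) with hE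
  have hE0 : 0 < E := Real.exp_pos _
  have key : Mem (-(E * phiSeries 0 x * (E * phiSeries 0 x) * (E * phiSeries 3 x)) +
      ((3 : ℚ) : ℝ) * (E * phiSeries 0 x * (E * phiSeries 1 x) * (E * phiSeries 2 x)) +
      ((-2 : ℚ) : ℝ) * (E * phiSeries 1 x * (E * phiSeries 1 x) * (E * phiSeries 1 x))) (formTIv a h) := by
    unfold formTIv
    exact mem_ivAdd (mem_ivAdd (mem_ivNeg (mem_ivMul (mem_ivMul (hm 0) (hm 0)) (hm 3)))
      (mem_ivScale 3 (mem_ivMul (mem_ivMul (hm 0) (hm 1)) (hm 2))))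
      (mem_ivScale (-2) (mem_ivMul (mem_ivMul (hm 1) (hm 1)) (hm 1)))
  have hposR := pos_of_mem key hpos
  have e : -(E * phiSeries 0 x * (E * phiSeries 0 x) * (E * phiSeries 3 x)) +
      ((3 : ℚ) : ℝ) * (E * phiSeries 0 x * (E * phiSeries 1 x) * (E * phiSeries 2 x)) +
      ((-2 : ℚ) : ℝ) * (E * phiSeries 1 x * (E * phiSeries 1 x) * (E * phiSeries 1 x)) =
      E ^ 3 * (-(phiSeries 0 x ^ 2 * phiSeries 3 x) + 3 * phiSeries 0 x * phiSeries 1 x * phiSeries 2 x -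
      2 * phiSeries 1 x ^ 3) := by
    push_cast; ring
  rw [e] at hposR
  rcases (mul_pos_iff.mp hposR) with ⟨_, h2⟩ | ⟨h1, _⟩
  · exact h2
  · exact absurd h1 (not_lt.mpr (pow_pos hE0 3).le)

/-- **Regime N soundness**: `checkN (a, h, u_lo)` certifies `u(F₁² − F₀F₂) + F₀F₁ > 0` at `x = e^{4u}` with
`y_0 = πe^{4u} ∈ [a, a + h]` (the rational `u_lo ≤ u` is certified inside the check).
[cite: CsordasNorfolkVarga1986, the concavity of log Φ(√t) (= DimitrovLucas2011, Theorem B); kernel interval-arithmetic certificate (bookkeeping)] -/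
theorem formN_pos_of_checkN {a h ul : ℚ} (hc : checkN (a, h, ul) = true) {u : ℝ}
    (h1 : (a : ℝ) ≤ thetaFreq (Real.exp (4 * u)) 0) (h2 : thetaFreq (Real.exp (4 * u)) 0 ≤ (a : ℝ) + h) :
    0 < u * (phiSeries 1 (Real.exp (4 * u)) ^ 2 - phiSeries 0 (Real.exp (4 * u)) * phiSeries 2 (Real.exp (4 * u))) +
      phiSeries 0 (Real.exp (4 * u)) * phiSeries 1 (Real.exp (4 * u)) := by
  simp only [checkN, Bool.and_eq_true, decide_eq_true_eq] at hc
  obtain ⟨⟨⟨⟨⟨ha, hul0⟩, hul1⟩, hpi⟩, hP⟩, hpos⟩ := hc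
  set x := Real.exp (4 * u) with hxdef
  have hx : 0 < x := Real.exp_pos _
  have hm := fun m => mem_cellIv_phiSeries m ha hx h1 h2
  set E := Real.exp (thetaFreq x 0) with hE
  have hE0 : 0 < E := Real.exp_pos _
  -- `u_lo ≤ u`
  have hulo : (ul : ℝ) ≤ u := by
    by_contra hlt
    rw [not_le] at hlt
    have hexp : Real.exp (4 * u) < (expPosHi (4 * ul) : ℝ) := by
      calc Real.exp (4 * u) < Real.exp (((4 * ul : ℚ) : ℝ)) := Real.exp_lt_exp.2 (by push_cast; linarith)
        _ ≤ _ := exp_le_expPosHi (by linarith) hul1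
    have hy : thetaFreq x 0 = Real.pi * Real.exp (4 * u) := by simp [thetaFreq, hxdef]
    have hpi' : Real.pi ≤ (piHi : ℝ) := by
      have := Real.pi_lt_d20; unfold piHi; push_cast; linarith
    have hpos' : (0 : ℝ) < (expPosHi (4 * ul) : ℝ) := lt_trans (Real.exp_pos _) hexp
    have : thetaFreq x 0 < (a : ℝ) := by
      calc thetaFreq x 0 = Real.pi * Real.exp (4 * u) := hy
        _ < Real.pi * (expPosHi (4 * ul) : ℝ) := mul_lt_mul_of_pos_left hexp Real.pi_pos
        _ ≤ (piHi : ℝ) * (expPosHi (4 * ul) : ℝ) := mul_le_mul_of_nonneg_right hpi' hpos'.le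
        _ ≤ (a : ℝ) := by exact_mod_cast hpi
    linarith
  -- the two pieces
  have keyP : Mem (E * phiSeries 1 x * (E * phiSeries 1 x) + -(E * phiSeries 0 x * (E * phiSeries 2 x)))
      (ivAdd (ivMul (cellIv (Qc 1) a h) (cellIv (Qc 1) a h))
        (ivNeg (ivMul (cellIv (Qc 0) a h) (cellIv (Qc 2) a h)))) :=
    mem_ivAdd (mem_ivMul (hm 1) (hm 1)) (mem_ivNeg (mem_ivMul (hm 0) (hm 2)))
  have keyB : Mem (E * phiSeries 0 x * (E * phiSeries 1 x)) (ivMul (cellIv (Qc 0) a h) (cellIv (Qc 1) a h)) :=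
    mem_ivMul (hm 0) (hm 1)
  have hPR : ((ivAdd (ivMul (cellIv (Qc 1) a h) (cellIv (Qc 1) a h))
      (ivNeg (ivMul (cellIv (Qc 0) a h) (cellIv (Qc 2) a h)))).1 : ℝ) ≤
      E * phiSeries 1 x * (E * phiSeries 1 x) + -(E * phiSeries 0 x * (E * phiSeries 2 x)) := keyP.1
  have hBR := keyB.1
  have hP' : (0 : ℝ) < ((ivAdd (ivMul (cellIv (Qc 1) a h) (cellIv (Qc 1) a h))
      (ivNeg (ivMul (cellIv (Qc 0) a h) (cellIv (Qc 2) a h)))).1 : ℝ) := by exact_mod_cast hP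
  have hpos' : (0 : ℝ) < (ul : ℝ) * ((ivAdd (ivMul (cellIv (Qc 1) a h) (cellIv (Qc 1) a h))
      (ivNeg (ivMul (cellIv (Qc 0) a h) (cellIv (Qc 2) a h)))).1 : ℝ) +
      ((ivMul (cellIv (Qc 0) a h) (cellIv (Qc 1) a h)).1 : ℝ) := by exact_mod_cast hpos
  have hul0' : (0 : ℝ) ≤ (ul : ℝ) := by exact_mod_cast hul0
  have hmain : 0 < u * (E * phiSeries 1 x * (E * phiSeries 1 x) + -(E * phiSeries 0 x * (E * phiSeries 2 x))) +
      E * phiSeries 0 x * (E * phiSeries 1 x) := by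
    have step1 : (ul : ℝ) * ((ivAdd (ivMul (cellIv (Qc 1) a h) (cellIv (Qc 1) a h))
        (ivNeg (ivMul (cellIv (Qc 0) a h) (cellIv (Qc 2) a h)))).1 : ℝ) ≤
        u * (E * phiSeries 1 x * (E * phiSeries 1 x) + -(E * phiSeries 0 x * (E * phiSeries 2 x))) :=
      mul_le_mul hulo hPR hP'.le (hul0'.trans hulo)
    linarith
  have e : u * (E * phiSeries 1 x * (E * phiSeries 1 x) + -(E * phiSeries 0 x * (E * phiSeries 2 x))) +
      E * phiSeries 0 x * (E * phiSeries 1 x) =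
      E ^ 2 * (u * (phiSeries 1 x ^ 2 - phiSeries 0 x * phiSeries 2 x) + phiSeries 0 x * phiSeries 1 x) := by ring
  rw [e] at hmain
  rcases (mul_pos_iff.mp hmain) with ⟨_, h2⟩ | ⟨h1, _⟩
  · exact h2
  · exact absurd h1 (not_lt.mpr (pow_pos hE0 2).le)

/-! ## 9. Regions: a checked, covering list of cells certifies the form on a whole interval of `y_0` -/

/-- Regime A on a covered interval.
[cite: CsordasNorfolkVarga1986, the concavity of log Φ(√t) (= DimitrovLucas2011, Theorem B); kernel interval-arithmetic certificate (bookkeeping)] -/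
theorem formA_pos_of_all {cells : List (ℚ × ℚ)} {lo hi : ℚ} (hall : cells.all checkA = true)
    (hcov : covers cells lo hi = true) {x : ℝ} (hx : 0 < x) (h1 : (lo : ℝ) ≤ thetaFreq x 0)
    (h2 : thetaFreq x 0 ≤ (hi : ℝ)) :
    0 < -(phiSeries 0 x ^ 2 * phiSeries 4 x) + phiSeries 0 x * phiSeries 1 x * phiSeries 3 x +
      3 * phiSeries 0 x * phiSeries 2 x ^ 2 - 3 * phiSeries 1 x ^ 2 * phiSeries 2 x := by
  obtain ⟨c, hc, hc1, hc2⟩ := mem_cell_of_covers hcov h1 h2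
  have hck : checkA (c.1, c.2) = true := by simpa using List.all_eq_true.mp hall c hc
  exact formA_pos_of_checkA hck hx hc1 hc2

/-- Regime T on a covered interval.
[cite: CsordasNorfolkVarga1986, the concavity of log Φ(√t) (= DimitrovLucas2011, Theorem B); kernel interval-arithmetic certificate (bookkeeping)] -/
theorem formT_pos_of_all {cells : List (ℚ × ℚ)} {lo hi : ℚ} (hall : cells.all checkT = true)
    (hcov : covers cells lo hi = true) {x : ℝ} (hx : 0 < x) (h1 : (lo : ℝ) ≤ thetaFreq x 0)
    (h2 : thetaFreq x 0 ≤ (hi : ℝ)) :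
    0 < -(phiSeries 0 x ^ 2 * phiSeries 3 x) + 3 * phiSeries 0 x * phiSeries 1 x * phiSeries 2 x -
      2 * phiSeries 1 x ^ 3 := by
  obtain ⟨c, hc, hc1, hc2⟩ := mem_cell_of_covers hcov h1 h2
  have hck : checkT (c.1, c.2) = true := by simpa using List.all_eq_true.mp hall c hc
  exact formT_pos_of_checkT hck hx hc1 hc2

/-- Regime N on a covered interval (cells carry their `u_lo`).
[cite: CsordasNorfolkVarga1986, the concavity of log Φ(√t) (= DimitrovLucas2011, Theorem B); kernel interval-arithmetic certificate (bookkeeping)] -/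
theorem formN_pos_of_all {cells : List (ℚ × ℚ × ℚ)} {lo hi : ℚ} (hall : cells.all checkN = true)
    (hcov : covers (cells.map fun c => (c.1, c.2.1)) lo hi = true) {u : ℝ}
    (h1 : (lo : ℝ) ≤ thetaFreq (Real.exp (4 * u)) 0) (h2 : thetaFreq (Real.exp (4 * u)) 0 ≤ (hi : ℝ)) :
    0 < u * (phiSeries 1 (Real.exp (4 * u)) ^ 2 - phiSeries 0 (Real.exp (4 * u)) * phiSeries 2 (Real.exp (4 * u))) +
      phiSeries 0 (Real.exp (4 * u)) * phiSeries 1 (Real.exp (4 * u)) := by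
  obtain ⟨c, hc, hc1, hc2⟩ := mem_cell_of_covers hcov h1 h2
  obtain ⟨c', hc', rfl⟩ := List.mem_map.mp hc
  have hck : checkN (c'.1, c'.2.1, c'.2.2) = true := by simpa using List.all_eq_true.mp hall c' hc'
  exact formN_pos_of_checkN hck hc1 hc2

end Literature.NumberTheory.LFunctions.DeBruijnPhiCells.CoeffTable

end Part4

/-!
## Part 5 — port of `Summits/RiemannHypothesis/RiemannHypothesis/Theorems/JensenPolynomialsPhiCells.lean` (13 declarations kept)

# Route `JensenPolynomials`, item `XiDeltaSqPos` (S-T5) — the kernel certificate: 129 checked cells covering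
`y₀ = πe^{4u}` for `u ∈ [0, 1/4]` (RH-FREE; cell rh-jensen, HUMAN RULING D-0040)

The CELL LISTS of the interval certificate behind the zero-free discharge of the route's crux `XiDeltaSqPos`
(Csordas–Varga 1988, Theorem 2.2: `log Φ(√t)` strictly concave ⟸ `u ↦ −Φ′(u)/(uΦ(u))` increasing; here on
`(0, 1/4]`, the large-`u` half being the tree's `strictMonoOn_phiNegLogDeriv_div_quarter`). Each chunk theorem feeds an
explicit list of cells `[a, a + h]` (widths `1/32 … 1/16`, found by an exact-ℚ twin of the checker) to the soundness
theorems of toolbox 4 and discharges `cells.all check = true` and `covers cells lo hi = true` by `decide +kernel`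
(exact rational interval arithmetic evaluated by the kernel, ≈ 0.2 s per cell, default heartbeats; no `native_decide`,
axioms standard):

* regime A, `y₀ ∈ [3.14159265358979, 3.765]` (`u ∈ [0, 0.045]`), 20 cells: `−F₀²F₄ + F₀F₁F₃ + 3F₀F₂² − 3F₁²F₂ > 0`;
* regime T, `y₀ ∈ [3.75, 4.89]` (`u ∈ [0.045, 0.11]`), 36 cells: `−F₀²F₃ + 3F₀F₁F₂ − 2F₁³ > 0`;
* regime N, `y₀ ∈ [4.80, 8.545]` (`u ∈ [0.11, 1/4]`), 73 cells: `u(F₁² − F₀F₂) + F₀F₁ > 0`.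

WHAT THIS IS NOT: nothing here bears on the zeros of `ζ`; the statements are inequalities between the explicit theta
series `F_m(x) = ∑_n P_m(π(n+1)²x)e^{−π(n+1)²x}` of `Φ, Φ′, …, Φ⁗`. References: Csordas–Varga, Constr. Approx. 4
(1988), Thm 2.2 (Varga 1990 §3.3 (3.5) records the printed interval split `(0, 0.03] ∪ [0.03, 0.06] ∪ [0.056, ∞)`)
[CsordasVarga1988, Varga1990].

(Verbatim declaration-level port — the declarations listed in the Part header count — of the Summits-side module of the
RiemannHypothesis tree's Jensen-polynomial cell; cell / rung / item bookkeeping in the text above is historical.)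
-/

section Part5

namespace Literature.NumberTheory.LFunctions.DeBruijnPhiCells.CoeffTable

open Literature.NumberTheory.LFunctions

/-- formA certificate, chunk 1/2: `y₀ ∈ [3.14159, 3.45409]` (11 cells, `decide +kernel`).
[cite: CsordasNorfolkVarga1986, the concavity of log Φ(√t) (= DimitrovLucas2011, Theorem B); kernel interval-arithmetic certificate (bookkeeping)] -/
theorem formA_pos_on₁ {x : ℝ} (hx : 0 < x) (h1 : ((314159265358979 / 100000000000000 : ℚ) : ℝ) ≤ thetaFreq x 0)
    (h2 : thetaFreq x 0 ≤ ((345409265358979 / 100000000000000 : ℚ) : ℝ)) :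
    0 < -(phiSeries 0 x ^ 2 * phiSeries 4 x) + phiSeries 0 x * phiSeries 1 x * phiSeries 3 x +
      3 * phiSeries 0 x * phiSeries 2 x ^ 2 - 3 * phiSeries 1 x ^ 2 * phiSeries 2 x :=
  formA_pos_of_all (lo := 314159265358979 / 100000000000000) (hi := 345409265358979 / 100000000000000)
    (cells := [
      (314159265358979/100000000000000, 1/32), (317284265358979/100000000000000, 1/32), (320409265358979/100000000000000, 1/32), (323534265358979/100000000000000, 1/32),
      (326659265358979/100000000000000, 1/32), (329784265358979/100000000000000, 1/32), (332909265358979/100000000000000, 1/32), (336034265358979/100000000000000, 1/32),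
      (339159265358979/100000000000000, 1/32), (342284265358979/100000000000000, 1/32), (345409265358979/100000000000000, 1/32)])
    (by decide +kernel) (by decide +kernel) hx h1 h2

/-- formA certificate, chunk 2/2: `y₀ ∈ [3.45409, 3.765]` (10 cells, `decide +kernel`).
[cite: CsordasNorfolkVarga1986, the concavity of log Φ(√t) (= DimitrovLucas2011, Theorem B); kernel interval-arithmetic certificate (bookkeeping)] -/
theorem formA_pos_on₂ {x : ℝ} (hx : 0 < x) (h1 : ((345409265358979 / 100000000000000 : ℚ) : ℝ) ≤ thetaFreq x 0)
    (h2 : thetaFreq x 0 ≤ ((753 / 200 : ℚ) : ℝ)) :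
    0 < -(phiSeries 0 x ^ 2 * phiSeries 4 x) + phiSeries 0 x * phiSeries 1 x * phiSeries 3 x +
      3 * phiSeries 0 x * phiSeries 2 x ^ 2 - 3 * phiSeries 1 x ^ 2 * phiSeries 2 x :=
  formA_pos_of_all (lo := 345409265358979 / 100000000000000) (hi := 753 / 200)
    (cells := [
      (345409265358979/100000000000000, 1/32), (348534265358979/100000000000000, 1/32), (351659265358979/100000000000000, 1/32), (354784265358979/100000000000000, 1/32),
      (357909265358979/100000000000000, 1/32), (361034265358979/100000000000000, 1/32), (364159265358979/100000000000000, 1/32), (367284265358979/100000000000000, 1/32),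
      (370409265358979/100000000000000, 1/32), (373534265358979/100000000000000, 3063390891021/100000000000000)])
    (by decide +kernel) (by decide +kernel) hx h1 h2

/-- **formA certificate** on the whole range `y₀ ∈ [3.14159265, 3.765]` (20 cells in 2 chunks).
[cite: CsordasNorfolkVarga1986, the concavity of log Φ(√t) (= DimitrovLucas2011, Theorem B); kernel interval-arithmetic certificate (bookkeeping)] -/
theorem formA_pos_on {x : ℝ} (hx : 0 < x) (h1 : ((314159265358979 / 100000000000000 : ℚ) : ℝ) ≤ thetaFreq x 0)
    (h2 : thetaFreq x 0 ≤ ((753 / 200 : ℚ) : ℝ)) :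
    0 < -(phiSeries 0 x ^ 2 * phiSeries 4 x) + phiSeries 0 x * phiSeries 1 x * phiSeries 3 x +
      3 * phiSeries 0 x * phiSeries 2 x ^ 2 - 3 * phiSeries 1 x ^ 2 * phiSeries 2 x := by
  by_cases hm0 : thetaFreq x 0 ≤ ((345409265358979 / 100000000000000 : ℚ) : ℝ)
  · exact formA_pos_on₁ hx h1 hm0
  · exact formA_pos_on₂ hx (not_le.mp hm0).le h2

/-- formT certificate, chunk 1/3: `y₀ ∈ [3.75, 4.125]` (13 cells, `decide +kernel`).
[cite: CsordasNorfolkVarga1986, the concavity of log Φ(√t) (= DimitrovLucas2011, Theorem B); kernel interval-arithmetic certificate (bookkeeping)] -/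
theorem formT_pos_on₁ {x : ℝ} (hx : 0 < x) (h1 : ((15 / 4 : ℚ) : ℝ) ≤ thetaFreq x 0)
    (h2 : thetaFreq x 0 ≤ ((33 / 8 : ℚ) : ℝ)) :
    0 < -(phiSeries 0 x ^ 2 * phiSeries 3 x) + 3 * phiSeries 0 x * phiSeries 1 x * phiSeries 2 x -
      2 * phiSeries 1 x ^ 3 :=
  formT_pos_of_all (lo := 15 / 4) (hi := 33 / 8)
    (cells := [
      (15/4, 1/32), (121/32, 1/32), (61/16, 1/32), (123/32, 1/32),
      (31/8, 1/32), (125/32, 1/32), (63/16, 1/32), (127/32, 1/32),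
      (4, 1/32), (129/32, 1/32), (65/16, 1/32), (131/32, 1/32),
      (33/8, 1/32)])
    (by decide +kernel) (by decide +kernel) hx h1 h2

/-- formT certificate, chunk 2/3: `y₀ ∈ [4.125, 4.5]` (13 cells, `decide +kernel`).
[cite: CsordasNorfolkVarga1986, the concavity of log Φ(√t) (= DimitrovLucas2011, Theorem B); kernel interval-arithmetic certificate (bookkeeping)] -/
theorem formT_pos_on₂ {x : ℝ} (hx : 0 < x) (h1 : ((33 / 8 : ℚ) : ℝ) ≤ thetaFreq x 0)
    (h2 : thetaFreq x 0 ≤ ((9 / 2 : ℚ) : ℝ)) :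
    0 < -(phiSeries 0 x ^ 2 * phiSeries 3 x) + 3 * phiSeries 0 x * phiSeries 1 x * phiSeries 2 x -
      2 * phiSeries 1 x ^ 3 :=
  formT_pos_of_all (lo := 33 / 8) (hi := 9 / 2)
    (cells := [
      (33/8, 1/32), (133/32, 1/32), (67/16, 1/32), (135/32, 1/32),
      (17/4, 1/32), (137/32, 1/32), (69/16, 1/32), (139/32, 1/32),
      (35/8, 1/32), (141/32, 1/32), (71/16, 1/32), (143/32, 1/32),
      (9/2, 1/32)])
    (by decide +kernel) (by decide +kernel) hx h1 h2

/-- formT certificate, chunk 3/3: `y₀ ∈ [4.5, 4.89]` (12 cells, `decide +kernel`).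
[cite: CsordasNorfolkVarga1986, the concavity of log Φ(√t) (= DimitrovLucas2011, Theorem B); kernel interval-arithmetic certificate (bookkeeping)] -/
theorem formT_pos_on₃ {x : ℝ} (hx : 0 < x) (h1 : ((9 / 2 : ℚ) : ℝ) ≤ thetaFreq x 0)
    (h2 : thetaFreq x 0 ≤ ((489 / 100 : ℚ) : ℝ)) :
    0 < -(phiSeries 0 x ^ 2 * phiSeries 3 x) + 3 * phiSeries 0 x * phiSeries 1 x * phiSeries 2 x -
      2 * phiSeries 1 x ^ 3 :=
  formT_pos_of_all (lo := 9 / 2) (hi := 489 / 100)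
    (cells := [
      (9/2, 1/32), (145/32, 1/32), (73/16, 1/32), (147/32, 1/32),
      (37/8, 1/32), (149/32, 1/32), (75/16, 1/32), (151/32, 1/32),
      (19/4, 1/32), (153/32, 1/32), (77/16, 1/32), (155/32, 1209/25600)])
    (by decide +kernel) (by decide +kernel) hx h1 h2

/-- **formT certificate** on the whole range `y₀ ∈ [3.75, 4.89]` (36 cells in 3 chunks).
[cite: CsordasNorfolkVarga1986, the concavity of log Φ(√t) (= DimitrovLucas2011, Theorem B); kernel interval-arithmetic certificate (bookkeeping)] -/
theorem formT_pos_on {x : ℝ} (hx : 0 < x) (h1 : ((15 / 4 : ℚ) : ℝ) ≤ thetaFreq x 0)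
    (h2 : thetaFreq x 0 ≤ ((489 / 100 : ℚ) : ℝ)) :
    0 < -(phiSeries 0 x ^ 2 * phiSeries 3 x) + 3 * phiSeries 0 x * phiSeries 1 x * phiSeries 2 x -
      2 * phiSeries 1 x ^ 3 := by
  by_cases hm0 : thetaFreq x 0 ≤ ((33 / 8 : ℚ) : ℝ)
  · exact formT_pos_on₁ hx h1 hm0
  · by_cases hm1 : thetaFreq x 0 ≤ ((9 / 2 : ℚ) : ℝ)
    · exact formT_pos_on₂ hx (not_le.mp hm0).le hm1
    · exact formT_pos_on₃ hx (not_le.mp hm1).le h2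

/-- formN certificate, chunk 1/5: `y₀ ∈ [4.8, 5.26875]` (16 cells, `decide +kernel`).
[cite: CsordasNorfolkVarga1986, the concavity of log Φ(√t) (= DimitrovLucas2011, Theorem B); kernel interval-arithmetic certificate (bookkeeping)] -/
theorem formN_pos_on₁ {u : ℝ} (h1 : ((24 / 5 : ℚ) : ℝ) ≤ thetaFreq (Real.exp (4 * u)) 0)
    (h2 : thetaFreq (Real.exp (4 * u)) 0 ≤ ((843 / 160 : ℚ) : ℝ)) :
    0 < u * (phiSeries 1 (Real.exp (4 * u)) ^ 2 - phiSeries 0 (Real.exp (4 * u)) * phiSeries 2 (Real.exp (4 * u))) +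
      phiSeries 0 (Real.exp (4 * u)) * phiSeries 1 (Real.exp (4 * u)) :=
  formN_pos_of_all (lo := 24 / 5) (hi := 843 / 160)
    (cells := [
      (24/5, 1/32, 2649/25000), (773/160, 1/32, 10759/100000), (389/80, 1/32, 273/2500),
      (783/160, 1/32, 277/2500), (197/40, 1/32, 11239/100000), (793/160, 1/32, 11397/100000),
      (399/80, 1/32, 5777/50000), (803/160, 1/32, 1171/10000), (101/20, 1/32, 5933/50000),
      (813/160, 1/32, 601/5000), (409/80, 1/32, 12173/100000), (823/160, 1/32, 6163/50000),
      (207/40, 1/32, 12477/100000), (833/160, 1/32, 12627/100000), (419/80, 1/32, 12777/100000),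
      (843/160, 1/32, 6463/50000)])
    (by decide +kernel) (by decide +kernel) h1 h2

/-- formN certificate, chunk 2/5: `y₀ ∈ [5.26875, 5.89375]` (16 cells, `decide +kernel`).
[cite: CsordasNorfolkVarga1986, the concavity of log Φ(√t) (= DimitrovLucas2011, Theorem B); kernel interval-arithmetic certificate (bookkeeping)] -/
theorem formN_pos_on₂ {u : ℝ} (h1 : ((843 / 160 : ℚ) : ℝ) ≤ thetaFreq (Real.exp (4 * u)) 0)
    (h2 : thetaFreq (Real.exp (4 * u)) 0 ≤ ((943 / 160 : ℚ) : ℝ)) :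
    0 < u * (phiSeries 1 (Real.exp (4 * u)) ^ 2 - phiSeries 0 (Real.exp (4 * u)) * phiSeries 2 (Real.exp (4 * u))) +
      phiSeries 0 (Real.exp (4 * u)) * phiSeries 1 (Real.exp (4 * u)) :=
  formN_pos_of_all (lo := 843 / 160) (hi := 943 / 160)
    (cells := [
      (843/160, 1/32, 6463/50000), (53/10, 1/32, 6537/50000), (853/160, 1/32, 13221/100000),
      (429/80, 1/32, 13367/100000), (863/160, 1/32, 1689/12500), (217/40, 1/32, 1707/12500),
      (873/160, 1/32, 69/500), (439/80, 1/32, 13943/100000), (883/160, 1/32, 2817/20000),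
      (111/20, 1/32, 7113/50000), (893/160, 1/16, 7183/50000), (903/160, 1/16, 2929/20000),
      (913/160, 1/16, 373/2500), (923/160, 1/16, 1899/12500), (933/160, 1/16, 7731/50000),
      (943/160, 1/16, 983/6250)])
    (by decide +kernel) (by decide +kernel) h1 h2

/-- formN certificate, chunk 3/5: `y₀ ∈ [5.89375, 6.83125]` (16 cells, `decide +kernel`).
[cite: CsordasNorfolkVarga1986, the concavity of log Φ(√t) (= DimitrovLucas2011, Theorem B); kernel interval-arithmetic certificate (bookkeeping)] -/
theorem formN_pos_on₃ {u : ℝ} (h1 : ((943 / 160 : ℚ) : ℝ) ≤ thetaFreq (Real.exp (4 * u)) 0)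
    (h2 : thetaFreq (Real.exp (4 * u)) 0 ≤ ((1093 / 160 : ℚ) : ℝ)) :
    0 < u * (phiSeries 1 (Real.exp (4 * u)) ^ 2 - phiSeries 0 (Real.exp (4 * u)) * phiSeries 2 (Real.exp (4 * u))) +
      phiSeries 0 (Real.exp (4 * u)) * phiSeries 1 (Real.exp (4 * u)) :=
  formN_pos_of_all (lo := 943 / 160) (hi := 1093 / 160)
    (cells := [
      (943/160, 1/16, 983/6250), (953/160, 1/16, 1999/12500), (963/160, 1/16, 16253/100000),
      (973/160, 1/16, 16511/100000), (983/160, 1/16, 16767/100000), (993/160, 1/16, 851/5000),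
      (1003/160, 1/16, 1727/10000), (1013/160, 1/16, 8759/50000), (1023/160, 1/16, 4441/25000),
      (1033/160, 1/16, 18007/100000), (1043/160, 1/16, 2281/12500), (1053/160, 1/16, 18487/100000),
      (1063/160, 1/16, 18723/100000), (1073/160, 1/16, 18957/100000), (1083/160, 1/16, 19189/100000),
      (1093/160, 1/16, 19419/100000)])
    (by decide +kernel) (by decide +kernel) h1 h2

/-- formN certificate, chunk 4/5: `y₀ ∈ [6.83125, 7.76875]` (16 cells, `decide +kernel`).
[cite: CsordasNorfolkVarga1986, the concavity of log Φ(√t) (= DimitrovLucas2011, Theorem B); kernel interval-arithmetic certificate (bookkeeping)] -/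
theorem formN_pos_on₄ {u : ℝ} (h1 : ((1093 / 160 : ℚ) : ℝ) ≤ thetaFreq (Real.exp (4 * u)) 0)
    (h2 : thetaFreq (Real.exp (4 * u)) 0 ≤ ((1243 / 160 : ℚ) : ℝ)) :
    0 < u * (phiSeries 1 (Real.exp (4 * u)) ^ 2 - phiSeries 0 (Real.exp (4 * u)) * phiSeries 2 (Real.exp (4 * u))) +
      phiSeries 0 (Real.exp (4 * u)) * phiSeries 1 (Real.exp (4 * u)) :=
  formN_pos_of_all (lo := 1093 / 160) (hi := 1243 / 160)
    (cells := [
      (1093/160, 1/16, 19419/100000), (1103/160, 1/16, 9823/50000), (1113/160, 1/16, 621/3125),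
      (1123/160, 1/16, 628/3125), (1133/160, 1/16, 20317/100000), (1143/160, 1/16, 20537/100000),
      (1153/160, 1/16, 4151/20000), (1163/160, 1/16, 20971/100000), (1173/160, 1/16, 4237/20000),
      (1183/160, 1/16, 21397/100000), (1193/160, 1/16, 21607/100000), (1203/160, 1/16, 2727/12500),
      (1213/160, 1/16, 22023/100000), (1223/160, 1/16, 5557/25000), (1233/160, 1/16, 701/3125),
      (1243/160, 1/16, 11317/50000)])
    (by decide +kernel) (by decide +kernel) h1 h2

/-- formN certificate, chunk 5/5: `y₀ ∈ [7.76875, 8.545]` (13 cells, `decide +kernel`).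
[cite: CsordasNorfolkVarga1986, the concavity of log Φ(√t) (= DimitrovLucas2011, Theorem B); kernel interval-arithmetic certificate (bookkeeping)] -/
theorem formN_pos_on₅ {u : ℝ} (h1 : ((1243 / 160 : ℚ) : ℝ) ≤ thetaFreq (Real.exp (4 * u)) 0)
    (h2 : thetaFreq (Real.exp (4 * u)) 0 ≤ ((1709 / 200 : ℚ) : ℝ)) :
    0 < u * (phiSeries 1 (Real.exp (4 * u)) ^ 2 - phiSeries 0 (Real.exp (4 * u)) * phiSeries 2 (Real.exp (4 * u))) +
      phiSeries 0 (Real.exp (4 * u)) * phiSeries 1 (Real.exp (4 * u)) :=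
  formN_pos_of_all (lo := 1243 / 160) (hi := 1709 / 200)
    (cells := [
      (1243/160, 1/16, 11317/50000), (1253/160, 1/16, 11417/50000), (1263/160, 1/16, 23033/100000),
      (1273/160, 1/16, 2323/10000), (1283/160, 1/16, 11713/50000), (1293/160, 1/16, 1181/5000),
      (1303/160, 1/16, 5953/25000), (1313/160, 1/16, 24003/100000), (1323/160, 1/16, 24193/100000),
      (1333/160, 1/16, 24381/100000), (1343/160, 1/16, 3071/12500), (1353/160, 1/16, 12377/50000),
      (1363/160, 697/25600, 12469/50000)])
    (by decide +kernel) (by decide +kernel) h1 h2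

/-- **formN certificate** on the whole range `y₀ ∈ [4.8, 8.545]` (73 cells in 5 chunks).
[cite: CsordasNorfolkVarga1986, the concavity of log Φ(√t) (= DimitrovLucas2011, Theorem B); kernel interval-arithmetic certificate (bookkeeping)] -/
theorem formN_pos_on {u : ℝ} (h1 : ((24 / 5 : ℚ) : ℝ) ≤ thetaFreq (Real.exp (4 * u)) 0)
    (h2 : thetaFreq (Real.exp (4 * u)) 0 ≤ ((1709 / 200 : ℚ) : ℝ)) :
    0 < u * (phiSeries 1 (Real.exp (4 * u)) ^ 2 - phiSeries 0 (Real.exp (4 * u)) * phiSeries 2 (Real.exp (4 * u))) +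
      phiSeries 0 (Real.exp (4 * u)) * phiSeries 1 (Real.exp (4 * u)) := by
  by_cases hm0 : thetaFreq (Real.exp (4 * u)) 0 ≤ ((843 / 160 : ℚ) : ℝ)
  · exact formN_pos_on₁ h1 hm0
  · by_cases hm1 : thetaFreq (Real.exp (4 * u)) 0 ≤ ((943 / 160 : ℚ) : ℝ)
    · exact formN_pos_on₂ (not_le.mp hm0).le hm1
    · by_cases hm2 : thetaFreq (Real.exp (4 * u)) 0 ≤ ((1093 / 160 : ℚ) : ℝ)
      · exact formN_pos_on₃ (not_le.mp hm1).le hm2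
      · by_cases hm3 : thetaFreq (Real.exp (4 * u)) 0 ≤ ((1243 / 160 : ℚ) : ℝ)
        · exact formN_pos_on₄ (not_le.mp hm2).le hm3
        · exact formN_pos_on₅ (not_le.mp hm3).le h2

end Literature.NumberTheory.LFunctions.DeBruijnPhiCells.CoeffTable

end Part5

/-!
## Part 6 — port of `Summits/RiemannHypothesis/RiemannHypothesis/Theorems/JensenPolynomialsPhiHigherDeriv.lean` (12 declarations kept)

# Route `JensenPolynomials`, item `XiDeltaSqPos` (S-T5) — toolbox 1: the third and fourth derivatives of the
Pólya–de Bruijn kernel `Φ` and their theta series (RH-FREE; cell rh-jensen, HUMAN RULING D-0040)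

Companion (problem-side, it serves only the zero-free discharge of the route's crux `XiDeltaSqPos`) of the Literature files `DeBruijnPhiDeriv.lean` (`Φ′ = deBruijnPhiDeriv`),
`DeBruijnPhiSecondDeriv.lean` (`Φ″ = deBruijnPhiDeriv₂`, the one-series forms in the frequencies `y_n = π(n+1)²e^{4u}`)
and `DeBruijnPhiThetaTails.lean` (`Φ″` is even). For the tree's Rodgers–Tao-normalised kernel `Φ = deBruijnPhi` we add the
next two derivatives, which are the inputs of Csordas–Varga's proof that `log Φ(√t)` is strictly concave
(Csordas–Varga 1988, Theorem 2.2 — "a lengthy construction … established bounds for `Φ^{(j)}(t)` (`j = 1, …, 6`)",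
Varga 1990 §3.3), i.e. of the strict Turán inequalities of the Taylor coefficients of `ξ` (Csordas–Norfolk–Varga 1986):

* `deBruijnPhiDeriv₃`, `deBruijnPhiDeriv₄` with `hasDerivAt_deBruijnPhiDeriv₂` (`(Φ″)′ = Φ‴`) and
  `hasDerivAt_deBruijnPhiDeriv₃` (`(Φ‴)′ = Φ⁗`), as combinations of the tree's building blocks `E_{j,k}(2u)`
  (`E_{j,k}′ = (1/2 + 2j)E_{j,k} − 2E_{j+1,k+1}`):
  `Φ‴ = 3270E₂₂ − 4232E₃₃ + 1440E₄₄ − 375E₁₁ − 128E₅₅`,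
  `Φ⁗ = 30930E₂₂ − 68096E₃₃ + 41408E₄₄ − 8448E₅₅ − 1875E₁₁ + 512E₆₆` (at `2u`);
* the generic degree-six term `phiPolyTerm6 a₁ … a₆ x n = (a₁y + ⋯ + a₆y⁶)e^{−y}`, `y = y_n(x) = π(n+1)²x`, with its
  summability and sum, and the ONE-SERIES forms
  `Φ‴(u) = eᵘ ∑_n P₃(y_n)e^{−y_n}`, `P₃(y) = −128y⁵ + 1440y⁴ − 4232y³ + 3270y² − 375y` (`deBruijnPhiDeriv₃_eq_tsum`),
  `Φ⁗(u) = eᵘ ∑_n P₄(y_n)e^{−y_n}`, `P₄(y) = 512y⁶ − 8448y⁵ + 41408y⁴ − 68096y³ + 30930y² − 1875y`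
  (`deBruijnPhiDeriv₄_eq_tsum`); the polynomials obey `P_{m+1}(y) = P_m(y) + 4y(P_m′(y) − P_m(y))`;
* parity: `Φ‴` is odd (`deBruijnPhiDeriv₃_neg_arg`), hence `Φ‴(0) = 0` (`deBruijnPhiDeriv₃_zero`).

WHAT THIS IS NOT: nothing here bears on the zeros of `ζ`. Everything is proved (term-by-term differentiation is the tree's `hasDerivAt_expThetaMoment`); no named facts.
Not here: any sign information on `Φ‴`, `Φ⁗` (that is the numerical content of Csordas–Varga's lemmas, done by interval
arithmetic where it is used).

## References

* G. Csordas, R. S. Varga, *Moment inequalities and the Riemann hypothesis*, Constr. Approx. 4 (1988) 175–198,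
  Theorem 2.2. [CsordasVarga1988]
* R. S. Varga, *Scientific Computation on Mathematical Problems and Conjectures*, SIAM (1990), §3.3, Theorem 3,
  (3.4)–(3.5). [Varga1990]
* E. C. Titchmarsh, *The Theory of the Riemann Zeta-Function*, 2nd ed. (1986), §10.1. [Titchmarsh1986]

(Verbatim declaration-level port — the declarations listed in the Part header count — of the Summits-side module of the
RiemannHypothesis tree's Jensen-polynomial cell; cell / rung / item bookkeeping in the text above is historical.)
-/

section Part6

open _root_.Filter _root_.Topology _root_.Set
open scoped _root_.Real

namespace Literature.NumberTheory.LFunctions.DeBruijnPhiCells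

open Literature.NumberTheory.LFunctions

/-! ## 1. The third and fourth derivatives -/

/-- The third derivative of `Φ`:
`Φ‴(u) = 3270E_{2,2}(2u) − 4232E_{3,3}(2u) + 1440E_{4,4}(2u) − 375E_{1,1}(2u) − 128E_{5,5}(2u)`.
[cite: CsordasNorfolkVarga1986, the concavity of log Φ(√t) (= DimitrovLucas2011, Theorem B); kernel interval-arithmetic certificate (bookkeeping)] -/
def deBruijnPhiDeriv₃ (u : ℝ) : ℝ :=
  3270 * expThetaMoment 2 2 (2 * u) - 4232 * expThetaMoment 3 3 (2 * u) + 1440 * expThetaMoment 4 4 (2 * u) -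
    375 * expThetaMoment 1 1 (2 * u) - 128 * expThetaMoment 5 5 (2 * u)

/-- The fourth derivative of `Φ`:
`Φ⁗(u) = 30930E_{2,2}(2u) − 68096E_{3,3}(2u) + 41408E_{4,4}(2u) − 8448E_{5,5}(2u) − 1875E_{1,1}(2u) + 512E_{6,6}(2u)`.
[cite: CsordasNorfolkVarga1986, the concavity of log Φ(√t) (= DimitrovLucas2011, Theorem B); kernel interval-arithmetic certificate (bookkeeping)] -/
def deBruijnPhiDeriv₄ (u : ℝ) : ℝ :=
  30930 * expThetaMoment 2 2 (2 * u) - 68096 * expThetaMoment 3 3 (2 * u) + 41408 * expThetaMoment 4 4 (2 * u) -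
    8448 * expThetaMoment 5 5 (2 * u) - 1875 * expThetaMoment 1 1 (2 * u) + 512 * expThetaMoment 6 6 (2 * u)

/-- The derivative of `u ↦ E_{k,k}(2u)`: `(1 + 4k)E_{k,k}(2u) − 4E_{k+1,k+1}(2u)`.
[cite: CsordasNorfolkVarga1986, the concavity of log Φ(√t) (= DimitrovLucas2011, Theorem B); kernel interval-arithmetic certificate (bookkeeping)] -/
theorem hasDerivAt_expThetaMoment_two_mul (k : ℕ) (u : ℝ) :
    HasDerivAt (fun u : ℝ => expThetaMoment k k (2 * u))
      ((1 + 4 * (k : ℝ)) * expThetaMoment k k (2 * u) - 4 * expThetaMoment (k + 1) (k + 1) (2 * u)) u := by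
  have h2 : HasDerivAt (fun u : ℝ => 2 * u) 2 u := by
    simpa using (hasDerivAt_id u).const_mul (2 : ℝ)
  have h := (hasDerivAt_expThetaMoment k k (2 * u)).comp u h2
  have e : ((1 / 2 + 2 * (k : ℝ)) * expThetaMoment k k (2 * u) - 2 * expThetaMoment (k + 1) (k + 1) (2 * u)) * 2 =
      (1 + 4 * (k : ℝ)) * expThetaMoment k k (2 * u) - 4 * expThetaMoment (k + 1) (k + 1) (2 * u) := by ring
  rw [← e]
  exact h

/-- `Φ″` is differentiable with derivative `Φ‴ = deBruijnPhiDeriv₃`.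
[cite: CsordasNorfolkVarga1986, the concavity of log Φ(√t) (= DimitrovLucas2011, Theorem B); kernel interval-arithmetic certificate (bookkeeping)] -/
theorem hasDerivAt_deBruijnPhiDeriv₂ (u : ℝ) : HasDerivAt deBruijnPhiDeriv₂ (deBruijnPhiDeriv₃ u) u := by
  have hA := (hasDerivAt_expThetaMoment_two_mul 2 u).const_mul 330
  have hB := (hasDerivAt_expThetaMoment_two_mul 3 u).const_mul 224
  have hC := (hasDerivAt_expThetaMoment_two_mul 1 u).const_mul 75
  have hD := (hasDerivAt_expThetaMoment_two_mul 4 u).const_mul 32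
  have h := ((hA.sub hB).sub hC).add hD
  have ef : deBruijnPhiDeriv₂ = fun u => 330 * expThetaMoment 2 2 (2 * u) - 224 * expThetaMoment 3 3 (2 * u) -
      75 * expThetaMoment 1 1 (2 * u) + 32 * expThetaMoment 4 4 (2 * u) := rfl
  have e : 330 * ((1 + 4 * ((2 : ℕ) : ℝ)) * expThetaMoment 2 2 (2 * u) - 4 * expThetaMoment (2 + 1) (2 + 1) (2 * u)) -
      224 * ((1 + 4 * ((3 : ℕ) : ℝ)) * expThetaMoment 3 3 (2 * u) - 4 * expThetaMoment (3 + 1) (3 + 1) (2 * u)) -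
      75 * ((1 + 4 * ((1 : ℕ) : ℝ)) * expThetaMoment 1 1 (2 * u) - 4 * expThetaMoment (1 + 1) (1 + 1) (2 * u)) +
      32 * ((1 + 4 * ((4 : ℕ) : ℝ)) * expThetaMoment 4 4 (2 * u) - 4 * expThetaMoment (4 + 1) (4 + 1) (2 * u)) =
      deBruijnPhiDeriv₃ u := by
    simp only [deBruijnPhiDeriv₃, Nat.cast_ofNat, Nat.cast_one]
    norm_num
    ring
  rw [ef, ← e]
  exact h

/-- `Φ‴` is differentiable with derivative `Φ⁗ = deBruijnPhiDeriv₄`.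
[cite: CsordasNorfolkVarga1986, the concavity of log Φ(√t) (= DimitrovLucas2011, Theorem B); kernel interval-arithmetic certificate (bookkeeping)] -/
theorem hasDerivAt_deBruijnPhiDeriv₃ (u : ℝ) : HasDerivAt deBruijnPhiDeriv₃ (deBruijnPhiDeriv₄ u) u := by
  have hA := (hasDerivAt_expThetaMoment_two_mul 2 u).const_mul 3270
  have hB := (hasDerivAt_expThetaMoment_two_mul 3 u).const_mul 4232
  have hC := (hasDerivAt_expThetaMoment_two_mul 4 u).const_mul 1440
  have hD := (hasDerivAt_expThetaMoment_two_mul 1 u).const_mul 375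
  have hE := (hasDerivAt_expThetaMoment_two_mul 5 u).const_mul 128
  have h := (((hA.sub hB).add hC).sub hD).sub hE
  have ef : deBruijnPhiDeriv₃ = fun u => 3270 * expThetaMoment 2 2 (2 * u) - 4232 * expThetaMoment 3 3 (2 * u) +
      1440 * expThetaMoment 4 4 (2 * u) - 375 * expThetaMoment 1 1 (2 * u) - 128 * expThetaMoment 5 5 (2 * u) := rfl
  have e : 3270 * ((1 + 4 * ((2 : ℕ) : ℝ)) * expThetaMoment 2 2 (2 * u) - 4 * expThetaMoment (2 + 1) (2 + 1) (2 * u)) -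
      4232 * ((1 + 4 * ((3 : ℕ) : ℝ)) * expThetaMoment 3 3 (2 * u) - 4 * expThetaMoment (3 + 1) (3 + 1) (2 * u)) +
      1440 * ((1 + 4 * ((4 : ℕ) : ℝ)) * expThetaMoment 4 4 (2 * u) - 4 * expThetaMoment (4 + 1) (4 + 1) (2 * u)) -
      375 * ((1 + 4 * ((1 : ℕ) : ℝ)) * expThetaMoment 1 1 (2 * u) - 4 * expThetaMoment (1 + 1) (1 + 1) (2 * u)) -
      128 * ((1 + 4 * ((5 : ℕ) : ℝ)) * expThetaMoment 5 5 (2 * u) - 4 * expThetaMoment (5 + 1) (5 + 1) (2 * u)) =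
      deBruijnPhiDeriv₄ u := by
    simp only [deBruijnPhiDeriv₄, Nat.cast_ofNat, Nat.cast_one]
    norm_num
    ring
  rw [ef, ← e]
  exact h

/-- The generic term `(a₁y + a₂y² + a₃y³ + a₄y⁴ + a₅y⁵ + a₆y⁶)e^{−y}` at `y = y_n(x) = π(n+1)²x`.
[cite: CsordasNorfolkVarga1986, the concavity of log Φ(√t) (= DimitrovLucas2011, Theorem B); kernel interval-arithmetic certificate (bookkeeping)] -/
def phiPolyTerm6 (a₁ a₂ a₃ a₄ a₅ a₆ x : ℝ) (n : ℕ) : ℝ :=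
  (a₁ * thetaFreq x n + a₂ * thetaFreq x n ^ 2 + a₃ * thetaFreq x n ^ 3 + a₄ * thetaFreq x n ^ 4 +
    a₅ * thetaFreq x n ^ 5 + a₆ * thetaFreq x n ^ 6) * rexp (-thetaFreq x n)

/-- The generic degree-six term is a combination of theta-moment terms.
[cite: CsordasNorfolkVarga1986, the concavity of log Φ(√t) (= DimitrovLucas2011, Theorem B); kernel interval-arithmetic certificate (bookkeeping)] -/
theorem phiPolyTerm6_eq (a₁ a₂ a₃ a₄ a₅ a₆ x : ℝ) (n : ℕ) :
    phiPolyTerm6 a₁ a₂ a₃ a₄ a₅ a₆ x n = a₁ * (x ^ 1 * thetaMomentTerm 1 x n) +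
      a₂ * (x ^ 2 * thetaMomentTerm 2 x n) + a₃ * (x ^ 3 * thetaMomentTerm 3 x n) +
      a₄ * (x ^ 4 * thetaMomentTerm 4 x n) + a₅ * (x ^ 5 * thetaMomentTerm 5 x n) +
      a₆ * (x ^ 6 * thetaMomentTerm 6 x n) := by
  simp only [pow_mul_thetaMomentTerm, phiPolyTerm6]
  ring

/-- The generic degree-six series sums to `∑_k a_k x^k ψ_k(x)`.
[cite: CsordasNorfolkVarga1986, the concavity of log Φ(√t) (= DimitrovLucas2011, Theorem B); kernel interval-arithmetic certificate (bookkeeping)] -/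
theorem tsum_phiPolyTerm6 (a₁ a₂ a₃ a₄ a₅ a₆ : ℝ) {x : ℝ} (hx : 0 < x) :
    ∑' n, phiPolyTerm6 a₁ a₂ a₃ a₄ a₅ a₆ x n = a₁ * (x ^ 1 * thetaMoment 1 x) +
      a₂ * (x ^ 2 * thetaMoment 2 x) + a₃ * (x ^ 3 * thetaMoment 3 x) + a₄ * (x ^ 4 * thetaMoment 4 x) +
      a₅ * (x ^ 5 * thetaMoment 5 x) + a₆ * (x ^ 6 * thetaMoment 6 x) := by
  have h : ∀ k : ℕ, ∀ a : ℝ, Summable fun n => a * (x ^ k * thetaMomentTerm k x n) := fun k a =>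
    ((summable_thetaMomentTerm k hx).mul_left (x ^ k)).mul_left a
  have e : ∀ k : ℕ, ∀ a : ℝ, ∑' n, a * (x ^ k * thetaMomentTerm k x n) = a * (x ^ k * thetaMoment k x) :=
    fun k a => by rw [tsum_mul_left, tsum_mul_left, thetaMoment]
  rw [tsum_congr (phiPolyTerm6_eq a₁ a₂ a₃ a₄ a₅ a₆ x),
    (((((h 1 a₁).add (h 2 a₂)).add (h 3 a₃)).add (h 4 a₄)).add (h 5 a₅)).tsum_add (h 6 a₆),
    ((((h 1 a₁).add (h 2 a₂)).add (h 3 a₃)).add (h 4 a₄)).tsum_add (h 5 a₅),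
    (((h 1 a₁).add (h 2 a₂)).add (h 3 a₃)).tsum_add (h 4 a₄),
    ((h 1 a₁).add (h 2 a₂)).tsum_add (h 3 a₃), (h 1 a₁).tsum_add (h 2 a₂), e, e, e, e, e, e]

/-- **`Φ‴` as one series**: `Φ‴(u) = eᵘ ∑_n P₃(y_n) e^{−y_n}` with
`P₃(y) = −128y⁵ + 1440y⁴ − 4232y³ + 3270y² − 375y`, `y_n = π(n+1)²e^{4u}`.
[cite: CsordasNorfolkVarga1986, the concavity of log Φ(√t) (= DimitrovLucas2011, Theorem B); kernel interval-arithmetic certificate (bookkeeping)] -/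
theorem deBruijnPhiDeriv₃_eq_tsum (u : ℝ) :
    deBruijnPhiDeriv₃ u = rexp u * ∑' n, phiPolyTerm6 (-375) 3270 (-4232) 1440 (-128) 0 (rexp (4 * u)) n := by
  rw [tsum_phiPolyTerm6 _ _ _ _ _ _ (Real.exp_pos _), deBruijnPhiDeriv₃, expThetaMoment_two_mul,
    expThetaMoment_two_mul, expThetaMoment_two_mul, expThetaMoment_two_mul, expThetaMoment_two_mul]
  ring

/-- **`Φ⁗` as one series**: `Φ⁗(u) = eᵘ ∑_n P₄(y_n) e^{−y_n}` with
`P₄(y) = 512y⁶ − 8448y⁵ + 41408y⁴ − 68096y³ + 30930y² − 1875y`.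
[cite: CsordasNorfolkVarga1986, the concavity of log Φ(√t) (= DimitrovLucas2011, Theorem B); kernel interval-arithmetic certificate (bookkeeping)] -/
theorem deBruijnPhiDeriv₄_eq_tsum (u : ℝ) :
    deBruijnPhiDeriv₄ u =
      rexp u * ∑' n, phiPolyTerm6 (-1875) 30930 (-68096) 41408 (-8448) 512 (rexp (4 * u)) n := by
  rw [tsum_phiPolyTerm6 _ _ _ _ _ _ (Real.exp_pos _), deBruijnPhiDeriv₄, expThetaMoment_two_mul,
    expThetaMoment_two_mul, expThetaMoment_two_mul, expThetaMoment_two_mul, expThetaMoment_two_mul,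
    expThetaMoment_two_mul]
  ring

/-- `Φ‴` is odd: `deBruijnPhiDeriv₃ (−u) = −deBruijnPhiDeriv₃ u` (from the evenness of `Φ″`,
`deBruijnPhiDeriv₂_neg_arg`, and uniqueness of derivatives).
(Csordas–Norfolk–Varga 1986, Theorem A (iii): `Φ` is even.)
[cite: CsordasNorfolkVarga1986, the concavity of log Φ(√t) (= DimitrovLucas2011, Theorem B); kernel interval-arithmetic certificate (bookkeeping)] -/
theorem deBruijnPhiDeriv₃_neg_arg (u : ℝ) : deBruijnPhiDeriv₃ (-u) = -deBruijnPhiDeriv₃ u := by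
  have hfun : (fun x => deBruijnPhiDeriv₂ (-x)) = fun x => deBruijnPhiDeriv₂ x :=
    funext fun x => deBruijnPhiDeriv₂_neg_arg x
  have h2 : HasDerivAt (fun x => deBruijnPhiDeriv₂ (-x)) (deBruijnPhiDeriv₃ (-u) * -1) u :=
    (hasDerivAt_deBruijnPhiDeriv₂ (-u)).comp u (hasDerivAt_neg u)
  have h3 : HasDerivAt (fun x => deBruijnPhiDeriv₂ (-x)) (deBruijnPhiDeriv₃ u) u := by
    rw [hfun]; exact hasDerivAt_deBruijnPhiDeriv₂ u
  have := h2.unique h3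
  linarith

/-- `Φ‴(0) = 0`.
(Csordas–Norfolk–Varga 1986, Theorem A (iii): `Φ` is even.)
[cite: CsordasNorfolkVarga1986, the concavity of log Φ(√t) (= DimitrovLucas2011, Theorem B); kernel interval-arithmetic certificate (bookkeeping)] -/
theorem deBruijnPhiDeriv₃_zero : deBruijnPhiDeriv₃ 0 = 0 := by
  have h := deBruijnPhiDeriv₃_neg_arg 0
  rw [neg_zero] at h
  linarith

end Literature.NumberTheory.LFunctions.DeBruijnPhiCells

end Part6

/-!
## Part 7 — port of `Summits/RiemannHypothesis/RiemannHypothesis/Theorems/JensenPolynomialsPhiMonotone.lean` (30 declarations kept)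

# Route `JensenPolynomials`, crux `XiDeltaSqPos` (S-T5) — Csordas–Varga's monotonicity of `−Φ′(u)/(uΦ(u))`
on `(0, 1/4]`, PROVED zero-free from the kernel interval certificate (RH-FREE; cell rh-jensen, HUMAN RULING D-0040)

The route's crux item `XiDeltaSqPos` (`Δ(M)² > 0` for all `M ≥ 2`, the strict Turán inequalities of `ξ`'s Taylor
data) was reduced in `JensenPolynomialsXiDeltaSqPosOfLogConcaveSqrt.lean` (Chebyshev covariance + integration by parts)
to ONE analytic statement about the Pólya–de Bruijn kernel near `0`: `u ↦ −Φ′(u)/(uΦ(u))` is non-decreasing on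
`(0, 1/4]` (the half `[1/4, ∞)` is that file's envelope argument). This file PROVES the statement — Csordas–Varga 1988,
Theorem 2.2 (`log Φ(√t)` strictly concave; "a lengthy construction (10 lemmas) establishing bounds for `Φ^{(j)}`,
`j ≤ 6`, on `(0, 0.03] ∪ [0.03, 0.06] ∪ [0.056, ∞)`", Varga 1990 §3.3 (3.5)) — in the kernel:

* §1 `Φ^{(m)}(u) = eᵘF_m(e^{4u})` for `m ≤ 4` (`F_m = phiSeries m`, the theta series of toolboxes 3–4);
* §2 the ranges of `y₀ = πe^{4u}` on the three regimes (`Real.pi_gt_d20`/`pi_lt_d20`, `Real.quadratic_le_exp_of_nonneg`,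
  `expPosHi`);
* §3 `T = −Φ²Φ‴ + 3ΦΦ′Φ″ − 2Φ′³ = V′Φ³` (`V = −(log Φ)″ = phiNegLogDeriv₂`): `T(0) = 0` (parity), `T′ = e^{3u}·formA > 0`
  on `[0, 0.045]` (certificate `formA_pos_on`, 20 cells) hence `T ≥ 0` there; `T = e^{3u}·formT > 0` on `[0.045, 0.11]`
  (`formT_pos_on`, 36 cells);
* §4 hence `V` is non-decreasing on `[0, 0.11]`, so `L = −Φ′/Φ` (`L(0) = 0`, `L′ = V`) is convex there and `L(u)/u` is
  non-decreasing on `(0, 0.11]`;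
* §5 on `[0.11, 1/4]`: `(L(u)/u)′ = N/(u²Φ²)` with `N = u(Φ′² − ΦΦ″) + ΦΦ′ = e^{2u}·formN > 0` (`formN_pos_on`, 73 cells);
* §6 union: `monotoneOn_negPhiDeriv_div_quarter` — `u ↦ −Φ′(u)/(uΦ(u))` is non-decreasing on `(0, 1/4]`.

The item closer (`xiDeltaSqPos_item`) and the discharge of the Literature named fact `DeBruijnPhiLogConcaveSqrt` are the
next file (they need the reduction file). Axioms standard (the certificate is `decide +kernel`); import closure
zero-free and height-free. WHAT THIS IS NOT: nothing here bears on the zeros of `ζ`.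

References: Csordas–Norfolk–Varga, Trans. AMS 296 (1986) [CsordasNorfolkVarga1986]; Csordas–Varga, Constr. Approx. 4
(1988), Thm 2.2 [CsordasVarga1988]; Varga, SIAM CBMS 60 (1990), §3.3 [Varga1990]; Coffey–Csordas, Math. Comp. 82 (2013)
[CoffeyCsordas2013].

(Verbatim declaration-level port — the declarations listed in the Part header count — of the Summits-side module of the
RiemannHypothesis tree's Jensen-polynomial cell; cell / rung / item bookkeeping in the text above is historical.)
-/

section Part7

namespace Literature.NumberTheory.LFunctions.DeBruijnPhiCells

open Literature.NumberTheory.LFunctions CoeffTable _root_.Set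
open scoped _root_.Real

/-! ## 1. The derivatives of `Φ` as the series `F_m`: `Φ^{(m)}(u) = eᵘ F_m(e^{4u})` -/

/-- `P₀` term.
[cite: CsordasNorfolkVarga1986, the concavity of log Φ(√t) (= DimitrovLucas2011, Theorem B); kernel interval-arithmetic certificate (bookkeeping)] -/
theorem phiPolyTerm_eq_qterm₀ (x : ℝ) (n : ℕ) : phiPolyTerm (-3) 2 0 0 x n = qterm (Qc 0) x n := by
  simp only [phiPolyTerm, qterm, Qc, pevalR]; push_cast; ring

/-- `P₁` term (the toolbox writes `Φ′ = −eᵘ∑(15y − 30y² + 8y³)e^{−y}`).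
[cite: CsordasNorfolkVarga1986, the concavity of log Φ(√t) (= DimitrovLucas2011, Theorem B); kernel interval-arithmetic certificate (bookkeeping)] -/
theorem phiPolyTerm_eq_qterm₁ (x : ℝ) (n : ℕ) : phiPolyTerm 15 (-30) 8 0 x n = -qterm (Qc 1) x n := by
  simp only [phiPolyTerm, qterm, Qc, pevalR]; push_cast; ring

/-- `P₂` term.
[cite: CsordasNorfolkVarga1986, the concavity of log Φ(√t) (= DimitrovLucas2011, Theorem B); kernel interval-arithmetic certificate (bookkeeping)] -/
theorem phiPolyTerm_eq_qterm₂ (x : ℝ) (n : ℕ) : phiPolyTerm (-75) 330 (-224) 32 x n = qterm (Qc 2) x n := by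
  simp only [phiPolyTerm, qterm, Qc, pevalR]; push_cast; ring

/-- `P₃` term.
[cite: CsordasNorfolkVarga1986, the concavity of log Φ(√t) (= DimitrovLucas2011, Theorem B); kernel interval-arithmetic certificate (bookkeeping)] -/
theorem phiPolyTerm6_eq_qterm₃ (x : ℝ) (n : ℕ) :
    phiPolyTerm6 (-375) 3270 (-4232) 1440 (-128) 0 x n = qterm (Qc 3) x n := by
  simp only [phiPolyTerm6, qterm, Qc, pevalR]; push_cast; ring

/-- `P₄` term.
[cite: CsordasNorfolkVarga1986, the concavity of log Φ(√t) (= DimitrovLucas2011, Theorem B); kernel interval-arithmetic certificate (bookkeeping)] -/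
theorem phiPolyTerm6_eq_qterm₄ (x : ℝ) (n : ℕ) :
    phiPolyTerm6 (-1875) 30930 (-68096) 41408 (-8448) 512 x n = qterm (Qc 4) x n := by
  simp only [phiPolyTerm6, qterm, Qc, pevalR]; push_cast; ring

/-- `Φ(u) = eᵘ F₀(e^{4u})`.
[cite: CsordasNorfolkVarga1986, the concavity of log Φ(√t) (= DimitrovLucas2011, Theorem B); kernel interval-arithmetic certificate (bookkeeping)] -/
theorem deBruijnPhi_eq_phiSeries (u : ℝ) : deBruijnPhi u = rexp u * phiSeries 0 (rexp (4 * u)) := by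
  rw [deBruijnPhi_eq_tsum, phiSeries, tsum_congr (phiPolyTerm_eq_qterm₀ _)]

/-- `Φ′(u) = eᵘ F₁(e^{4u})`.
[cite: CsordasNorfolkVarga1986, the concavity of log Φ(√t) (= DimitrovLucas2011, Theorem B); kernel interval-arithmetic certificate (bookkeeping)] -/
theorem deBruijnPhiDeriv_eq_phiSeries (u : ℝ) : deBruijnPhiDeriv u = rexp u * phiSeries 1 (rexp (4 * u)) := by
  rw [deBruijnPhiDeriv_eq_tsum, phiSeries, tsum_congr (phiPolyTerm_eq_qterm₁ _), tsum_neg]; ring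

/-- `Φ″(u) = eᵘ F₂(e^{4u})`.
[cite: CsordasNorfolkVarga1986, the concavity of log Φ(√t) (= DimitrovLucas2011, Theorem B); kernel interval-arithmetic certificate (bookkeeping)] -/
theorem deBruijnPhiDeriv₂_eq_phiSeries (u : ℝ) : deBruijnPhiDeriv₂ u = rexp u * phiSeries 2 (rexp (4 * u)) := by
  rw [deBruijnPhiDeriv₂_eq_tsum, phiSeries, tsum_congr (phiPolyTerm_eq_qterm₂ _)]

/-- `Φ‴(u) = eᵘ F₃(e^{4u})`.
[cite: CsordasNorfolkVarga1986, the concavity of log Φ(√t) (= DimitrovLucas2011, Theorem B); kernel interval-arithmetic certificate (bookkeeping)] -/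
theorem deBruijnPhiDeriv₃_eq_phiSeries (u : ℝ) : deBruijnPhiDeriv₃ u = rexp u * phiSeries 3 (rexp (4 * u)) := by
  rw [deBruijnPhiDeriv₃_eq_tsum, phiSeries, tsum_congr (phiPolyTerm6_eq_qterm₃ _)]

/-- `Φ⁗(u) = eᵘ F₄(e^{4u})`.
[cite: CsordasNorfolkVarga1986, the concavity of log Φ(√t) (= DimitrovLucas2011, Theorem B); kernel interval-arithmetic certificate (bookkeeping)] -/
theorem deBruijnPhiDeriv₄_eq_phiSeries (u : ℝ) : deBruijnPhiDeriv₄ u = rexp u * phiSeries 4 (rexp (4 * u)) := by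
  rw [deBruijnPhiDeriv₄_eq_tsum, phiSeries, tsum_congr (phiPolyTerm6_eq_qterm₄ _)]

/-- `y₀(e^{4u}) = πe^{4u}`.
[cite: CsordasNorfolkVarga1986, the concavity of log Φ(√t) (= DimitrovLucas2011, Theorem B); kernel interval-arithmetic certificate (bookkeeping)] -/
theorem thetaFreq_exp_zero (u : ℝ) : thetaFreq (rexp (4 * u)) 0 = π * rexp (4 * u) := by
  simp [thetaFreq]

/-! ## 2. The ranges of `y₀ = πe^{4u}` on the three `u`-regimes -/

/-- `π ≤ piHi`.
[cite: CsordasNorfolkVarga1986, the concavity of log Φ(√t) (= DimitrovLucas2011, Theorem B); kernel interval-arithmetic certificate (bookkeeping)] -/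
theorem pi_le_piHi : π ≤ ((piHi : ℚ) : ℝ) := by
  have := Real.pi_lt_d20; unfold piHi; push_cast; linarith

/-- Upper range: `πe^{4u} ≤ piHi·expPosHi(4b)` for `u ≤ b`, `0 ≤ 4b ≤ 1`.
[cite: CsordasNorfolkVarga1986, the concavity of log Φ(√t) (= DimitrovLucas2011, Theorem B); kernel interval-arithmetic certificate (bookkeeping)] -/
theorem thetaFreq_exp_le (b : ℚ) (hb0 : 0 ≤ 4 * b) (hb1 : 4 * b ≤ 1) {u : ℝ} (hub : u ≤ (b : ℝ)) :
    thetaFreq (rexp (4 * u)) 0 ≤ ((piHi * expPosHi (4 * b) : ℚ) : ℝ) := by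
  rw [thetaFreq_exp_zero]
  have h1 : rexp (4 * u) ≤ rexp (((4 * b : ℚ) : ℝ)) := Real.exp_le_exp.2 (by push_cast; linarith)
  have h2 := exp_le_expPosHi hb0 hb1
  push_cast
  exact mul_le_mul pi_le_piHi (h1.trans h2) (Real.exp_pos _).le (le_trans Real.pi_pos.le pi_le_piHi)

/-- Lower range: `πe^{4u} ≥ 3.14159265358979323846·(1 + 4a + 8a²)` for `u ≥ a ≥ 0`.
[cite: CsordasNorfolkVarga1986, the concavity of log Φ(√t) (= DimitrovLucas2011, Theorem B); kernel interval-arithmetic certificate (bookkeeping)] -/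
theorem le_thetaFreq_exp {u a : ℝ} (hau : a ≤ u) (ha : 0 ≤ a) :
    3.14159265358979323846 * (1 + 4 * a + (4 * a) ^ 2 / 2) ≤ thetaFreq (rexp (4 * u)) 0 := by
  rw [thetaFreq_exp_zero]
  have h1 : 1 + 4 * a + (4 * a) ^ 2 / 2 ≤ rexp (4 * u) :=
    (Real.quadratic_le_exp_of_nonneg (by linarith)).trans (Real.exp_le_exp.2 (by linarith))
  have h0 : (0 : ℝ) ≤ 1 + 4 * a + (4 * a) ^ 2 / 2 := by positivity
  exact mul_le_mul Real.pi_gt_d20.le h1 h0 Real.pi_pos.le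

/-! ## 3. Regime A and T: `T = −Φ²Φ‴ + 3ΦΦ′Φ″ − 2Φ′³ ≥ 0` on `[0, 11/100]` -/

/-- The derivative of `T = −Φ²Φ‴ + 3ΦΦ′Φ″ − 2Φ′³`: `T′ = −Φ²Φ⁗ + ΦΦ′Φ‴ + 3ΦΦ″² − 3Φ′²Φ″`.
[cite: CsordasNorfolkVarga1986, the concavity of log Φ(√t) (= DimitrovLucas2011, Theorem B); kernel interval-arithmetic certificate (bookkeeping)] -/
theorem hasDerivAt_turanT (u : ℝ) :
    HasDerivAt (fun u => -(deBruijnPhi u ^ 2 * deBruijnPhiDeriv₃ u) +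
        3 * deBruijnPhi u * deBruijnPhiDeriv u * deBruijnPhiDeriv₂ u - 2 * deBruijnPhiDeriv u ^ 3)
      (-(deBruijnPhi u ^ 2 * deBruijnPhiDeriv₄ u) + deBruijnPhi u * deBruijnPhiDeriv u * deBruijnPhiDeriv₃ u +
        3 * deBruijnPhi u * deBruijnPhiDeriv₂ u ^ 2 - 3 * deBruijnPhiDeriv u ^ 2 * deBruijnPhiDeriv₂ u) u := by
  have h0 := hasDerivAt_deBruijnPhi u
  have h1 := hasDerivAt_deBruijnPhiDeriv u
  have h2 := hasDerivAt_deBruijnPhiDeriv₂ u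
  have h3 := hasDerivAt_deBruijnPhiDeriv₃ u
  have hA := (h0.fun_mul h0).fun_mul h3
  have hB := ((h0.const_mul 3).fun_mul h1).fun_mul h2
  have hC := ((h1.fun_mul h1).fun_mul h1).const_mul 2
  have h := (hA.fun_neg.fun_add hB).fun_sub hC
  have ef : (fun u => -(deBruijnPhi u ^ 2 * deBruijnPhiDeriv₃ u) +
        3 * deBruijnPhi u * deBruijnPhiDeriv u * deBruijnPhiDeriv₂ u - 2 * deBruijnPhiDeriv u ^ 3) =
      (fun y => -(deBruijnPhi y * deBruijnPhi y * deBruijnPhiDeriv₃ y) +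
        3 * deBruijnPhi y * deBruijnPhiDeriv y * deBruijnPhiDeriv₂ y -
        2 * (deBruijnPhiDeriv y * deBruijnPhiDeriv y * deBruijnPhiDeriv y)) := by
    funext y; ring
  rw [ef]
  exact h.congr_deriv (by ring)

/-- `T(0) = 0` (`Φ′(0) = Φ‴(0) = 0` by parity).
[cite: CsordasNorfolkVarga1986, the concavity of log Φ(√t) (= DimitrovLucas2011, Theorem B); kernel interval-arithmetic certificate (bookkeeping)] -/
theorem turanT_zero : -(deBruijnPhi 0 ^ 2 * deBruijnPhiDeriv₃ 0) +
    3 * deBruijnPhi 0 * deBruijnPhiDeriv 0 * deBruijnPhiDeriv₂ 0 - 2 * deBruijnPhiDeriv 0 ^ 3 = 0 := by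
  have h1 : deBruijnPhiDeriv 0 = 0 := by
    have h := deBruijnPhiDeriv_neg 0; rw [neg_zero] at h; linarith
  rw [h1, deBruijnPhiDeriv₃_zero]; ring

/-- `T′(u) = e^{3u}·(−F₀²F₄ + F₀F₁F₃ + 3F₀F₂² − 3F₁²F₂)(e^{4u})`.
[cite: CsordasNorfolkVarga1986, the concavity of log Φ(√t) (= DimitrovLucas2011, Theorem B); kernel interval-arithmetic certificate (bookkeeping)] -/
theorem turanT'_eq (u : ℝ) :
    -(deBruijnPhi u ^ 2 * deBruijnPhiDeriv₄ u) + deBruijnPhi u * deBruijnPhiDeriv u * deBruijnPhiDeriv₃ u +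
        3 * deBruijnPhi u * deBruijnPhiDeriv₂ u ^ 2 - 3 * deBruijnPhiDeriv u ^ 2 * deBruijnPhiDeriv₂ u =
      rexp u ^ 3 * (-(phiSeries 0 (rexp (4 * u)) ^ 2 * phiSeries 4 (rexp (4 * u))) +
        phiSeries 0 (rexp (4 * u)) * phiSeries 1 (rexp (4 * u)) * phiSeries 3 (rexp (4 * u)) +
        3 * phiSeries 0 (rexp (4 * u)) * phiSeries 2 (rexp (4 * u)) ^ 2 -
        3 * phiSeries 1 (rexp (4 * u)) ^ 2 * phiSeries 2 (rexp (4 * u))) := by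
  rw [deBruijnPhi_eq_phiSeries, deBruijnPhiDeriv_eq_phiSeries, deBruijnPhiDeriv₂_eq_phiSeries,
    deBruijnPhiDeriv₃_eq_phiSeries, deBruijnPhiDeriv₄_eq_phiSeries]; ring

/-- `T(u) = e^{3u}·(−F₀²F₃ + 3F₀F₁F₂ − 2F₁³)(e^{4u})`.
[cite: CsordasNorfolkVarga1986, the concavity of log Φ(√t) (= DimitrovLucas2011, Theorem B); kernel interval-arithmetic certificate (bookkeeping)] -/
theorem turanT_eq (u : ℝ) :
    -(deBruijnPhi u ^ 2 * deBruijnPhiDeriv₃ u) +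
        3 * deBruijnPhi u * deBruijnPhiDeriv u * deBruijnPhiDeriv₂ u - 2 * deBruijnPhiDeriv u ^ 3 =
      rexp u ^ 3 * (-(phiSeries 0 (rexp (4 * u)) ^ 2 * phiSeries 3 (rexp (4 * u))) +
        3 * phiSeries 0 (rexp (4 * u)) * phiSeries 1 (rexp (4 * u)) * phiSeries 2 (rexp (4 * u)) -
        2 * phiSeries 1 (rexp (4 * u)) ^ 3) := by
  rw [deBruijnPhi_eq_phiSeries, deBruijnPhiDeriv_eq_phiSeries, deBruijnPhiDeriv₂_eq_phiSeries,
    deBruijnPhiDeriv₃_eq_phiSeries]; ring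

/-- Regime A: `T′(u) > 0` for `0 ≤ u ≤ 0.045` (kernel certificate `formA_pos_on`).
[cite: CsordasNorfolkVarga1986, the concavity of log Φ(√t) (= DimitrovLucas2011, Theorem B); kernel interval-arithmetic certificate (bookkeeping)] -/
theorem turanT'_pos {u : ℝ} (hu0 : 0 ≤ u) (hu1 : u ≤ 9 / 200) :
    0 < -(deBruijnPhi u ^ 2 * deBruijnPhiDeriv₄ u) + deBruijnPhi u * deBruijnPhiDeriv u * deBruijnPhiDeriv₃ u +
        3 * deBruijnPhi u * deBruijnPhiDeriv₂ u ^ 2 - 3 * deBruijnPhiDeriv u ^ 2 * deBruijnPhiDeriv₂ u := by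
  rw [turanT'_eq]
  refine mul_pos (pow_pos (Real.exp_pos u) 3) (formA_pos_on (Real.exp_pos _) ?_ ?_)
  · have h := le_thetaFreq_exp hu0 le_rfl
    push_cast; linarith
  · have h := thetaFreq_exp_le (9 / 200) (by norm_num) (by norm_num) (u := u) (by push_cast; linarith)
    exact h.trans (by exact_mod_cast (by decide +kernel : piHi * expPosHi (4 * (9 / 200)) ≤ (753 / 200 : ℚ)))

/-- Regime T: `T(u) > 0` for `0.045 ≤ u ≤ 0.11` (kernel certificate `formT_pos_on`).
[cite: CsordasNorfolkVarga1986, the concavity of log Φ(√t) (= DimitrovLucas2011, Theorem B); kernel interval-arithmetic certificate (bookkeeping)] -/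
theorem turanT_pos_mid {u : ℝ} (hu0 : 9 / 200 ≤ u) (hu1 : u ≤ 11 / 100) :
    0 < -(deBruijnPhi u ^ 2 * deBruijnPhiDeriv₃ u) +
        3 * deBruijnPhi u * deBruijnPhiDeriv u * deBruijnPhiDeriv₂ u - 2 * deBruijnPhiDeriv u ^ 3 := by
  rw [turanT_eq]
  refine mul_pos (pow_pos (Real.exp_pos u) 3) (formT_pos_on (Real.exp_pos _) ?_ ?_)
  · have h := le_thetaFreq_exp hu0 (by norm_num)
    exact le_trans (by norm_num) h
  · have h := thetaFreq_exp_le (11 / 100) (by norm_num) (by norm_num) (u := u) (by push_cast; linarith)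
    exact h.trans (by exact_mod_cast (by decide +kernel : piHi * expPosHi (4 * (11 / 100)) ≤ (489 / 100 : ℚ)))

/-- `T(u) ≥ 0` on `[0, 0.11]`: on `[0, 0.045]` from `T(0) = 0` and `T′ > 0`, on `[0.045, 0.11]` directly.
[cite: CsordasNorfolkVarga1986, the concavity of log Φ(√t) (= DimitrovLucas2011, Theorem B); kernel interval-arithmetic certificate (bookkeeping)] -/
theorem turanT_nonneg {u : ℝ} (hu0 : 0 ≤ u) (hu1 : u ≤ 11 / 100) :
    0 ≤ -(deBruijnPhi u ^ 2 * deBruijnPhiDeriv₃ u) +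
        3 * deBruijnPhi u * deBruijnPhiDeriv u * deBruijnPhiDeriv₂ u - 2 * deBruijnPhiDeriv u ^ 3 := by
  rcases le_or_gt u (9 / 200) with hsmall | hbig
  · -- monotone on `[0, 0.045]` from the positive derivative
    have hmono : MonotoneOn (fun u => -(deBruijnPhi u ^ 2 * deBruijnPhiDeriv₃ u) +
        3 * deBruijnPhi u * deBruijnPhiDeriv u * deBruijnPhiDeriv₂ u - 2 * deBruijnPhiDeriv u ^ 3) (Icc 0 (9 / 200)) := by
      refine monotoneOn_of_deriv_nonneg (convex_Icc _ _)
        (fun v _ => (hasDerivAt_turanT v).continuousAt.continuousWithinAt)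
        (fun v _ => (hasDerivAt_turanT v).differentiableAt.differentiableWithinAt) ?_
      intro v hv
      rw [interior_Icc] at hv
      rw [(hasDerivAt_turanT v).deriv]
      exact (turanT'_pos hv.1.le hv.2.le).le
    have h := hmono (show (0 : ℝ) ∈ Icc (0 : ℝ) (9 / 200) from ⟨le_rfl, by norm_num⟩) ⟨hu0, hsmall⟩ hu0
    simp only at h
    rw [turanT_zero] at h
    exact h
  · exact (turanT_pos_mid hbig.le hu1).le

/-! ## 4. `V = −(log Φ)″` is non-decreasing on `[0, 0.11]`, hence `L(u)/u` is on `(0, 0.11]` -/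

/-- `V′ = T/Φ³`.
[cite: CsordasNorfolkVarga1986, the concavity of log Φ(√t) (= DimitrovLucas2011, Theorem B); kernel interval-arithmetic certificate (bookkeeping)] -/
theorem hasDerivAt_phiNegLogDeriv₂ (u : ℝ) :
    HasDerivAt phiNegLogDeriv₂ ((-(deBruijnPhi u ^ 2 * deBruijnPhiDeriv₃ u) +
        3 * deBruijnPhi u * deBruijnPhiDeriv u * deBruijnPhiDeriv₂ u - 2 * deBruijnPhiDeriv u ^ 3) /
        deBruijnPhi u ^ 3) u := by
  have h0 := hasDerivAt_deBruijnPhi u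
  have h1 := hasDerivAt_deBruijnPhiDeriv u
  have h2 := hasDerivAt_deBruijnPhiDeriv₂ u
  have hΦ : deBruijnPhi u ≠ 0 := (deBruijnPhi_pos_holds u).ne'
  have hnum := (h1.fun_mul h1).fun_sub (h0.fun_mul h2)
  have hden := h0.fun_mul h0
  have h := hnum.div hden (mul_ne_zero hΦ hΦ)
  have ef : phiNegLogDeriv₂ = fun t => (deBruijnPhiDeriv t * deBruijnPhiDeriv t - deBruijnPhi t * deBruijnPhiDeriv₂ t) /
      (deBruijnPhi t * deBruijnPhi t) := by
    funext t; simp only [phiNegLogDeriv₂]; ring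
  rw [ef]
  refine h.congr_deriv ?_
  field_simp
  ring

/-- `V` is non-decreasing on `[0, 0.11]`.
[cite: CsordasNorfolkVarga1986, the concavity of log Φ(√t) (= DimitrovLucas2011, Theorem B); kernel interval-arithmetic certificate (bookkeeping)] -/
theorem monotoneOn_phiNegLogDeriv₂ : MonotoneOn phiNegLogDeriv₂ (Icc 0 (11 / 100)) := by
  refine monotoneOn_of_deriv_nonneg (convex_Icc _ _)
    (fun v _ => (hasDerivAt_phiNegLogDeriv₂ v).continuousAt.continuousWithinAt)
    (fun v _ => (hasDerivAt_phiNegLogDeriv₂ v).differentiableAt.differentiableWithinAt) ?_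
  intro v hv
  rw [interior_Icc] at hv
  rw [(hasDerivAt_phiNegLogDeriv₂ v).deriv]
  exact div_nonneg (turanT_nonneg hv.1.le hv.2.le) (pow_pos (deBruijnPhi_pos_holds v) 3).le

/-- `u ↦ −Φ′(u)/(uΦ(u)) = L(u)/u` is non-decreasing on `(0, 0.11]` (`L` is convex on `[0, 0.11]` with `L(0) = 0`, so its
chord slopes from `0` increase; the argument of `xiDeltaSqPos_of_monotoneOn_logConcavity` on the shorter window).
[cite: CsordasNorfolkVarga1986, the concavity of log Φ(√t) (= DimitrovLucas2011, Theorem B); kernel interval-arithmetic certificate (bookkeeping)] -/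
theorem monotoneOn_negPhiDeriv_div_small :
    MonotoneOn (fun u : ℝ => -deBruijnPhiDeriv u / (u * deBruijnPhi u)) (Ioc 0 (11 / 100)) := by
  have hconv : ConvexOn ℝ (Icc (0 : ℝ) (11 / 100)) phiNegLogDeriv := by
    refine MonotoneOn.convexOn_of_deriv (convex_Icc 0 (11 / 100)) continuous_phiNegLogDeriv.continuousOn
      (fun x _ => (hasDerivAt_phiNegLogDeriv x).differentiableAt.differentiableWithinAt) ?_
    rw [deriv_phiNegLogDeriv, interior_Icc]
    exact monotoneOn_phiNegLogDeriv₂.mono Ioo_subset_Icc_self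
  intro s hs t ht hst
  have hs0 : 0 < s := hs.1
  have ht0 : 0 < t := ht.1
  have hgs : -deBruijnPhiDeriv s / (s * deBruijnPhi s) = phiNegLogDeriv s / s := by
    simp only [phiNegLogDeriv]; rw [div_div, mul_comm]
  have hgt : -deBruijnPhiDeriv t / (t * deBruijnPhi t) = phiNegLogDeriv t / t := by
    simp only [phiNegLogDeriv]; rw [div_div, mul_comm]
  show -deBruijnPhiDeriv s / (s * deBruijnPhi s) ≤ -deBruijnPhiDeriv t / (t * deBruijnPhi t)
  rw [hgs, hgt]
  rcases eq_or_lt_of_le hst with rfl | hlt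
  · exact le_rfl
  have hslope := hconv.slope_mono_adjacent (x := 0) (y := s) (z := t)
    (Set.mem_Icc.2 ⟨le_rfl, by norm_num⟩) (Set.mem_Icc.2 ⟨ht0.le, ht.2⟩) hs0 hlt
  rw [phiNegLogDeriv_zero, sub_zero, sub_zero] at hslope
  rw [div_le_div_iff₀ hs0 ht0]
  have hts : 0 < t - s := by linarith
  rw [div_le_div_iff₀ hs0 hts] at hslope
  nlinarith [hslope]

/-! ## 5. Regime N: `N = u(Φ′² − ΦΦ″) + ΦΦ′ > 0` on `[0.11, 1/4]`, hence `L(u)/u` is increasing there -/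

/-- `N(u) = e^{2u}·(u(F₁² − F₀F₂) + F₀F₁)(e^{4u})`.
[cite: CsordasNorfolkVarga1986, the concavity of log Φ(√t) (= DimitrovLucas2011, Theorem B); kernel interval-arithmetic certificate (bookkeeping)] -/
theorem turanN_eq (u : ℝ) :
    u * (deBruijnPhiDeriv u ^ 2 - deBruijnPhi u * deBruijnPhiDeriv₂ u) + deBruijnPhi u * deBruijnPhiDeriv u =
      rexp u ^ 2 * (u * (phiSeries 1 (rexp (4 * u)) ^ 2 - phiSeries 0 (rexp (4 * u)) * phiSeries 2 (rexp (4 * u))) +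
        phiSeries 0 (rexp (4 * u)) * phiSeries 1 (rexp (4 * u))) := by
  rw [deBruijnPhi_eq_phiSeries, deBruijnPhiDeriv_eq_phiSeries, deBruijnPhiDeriv₂_eq_phiSeries]; ring

/-- Regime N: `N(u) > 0` for `0.11 ≤ u ≤ 1/4` (kernel certificate `formN_pos_on`).
[cite: CsordasNorfolkVarga1986, the concavity of log Φ(√t) (= DimitrovLucas2011, Theorem B); kernel interval-arithmetic certificate (bookkeeping)] -/
theorem turanN_pos {u : ℝ} (hu0 : 11 / 100 ≤ u) (hu1 : u ≤ 1 / 4) :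
    0 < u * (deBruijnPhiDeriv u ^ 2 - deBruijnPhi u * deBruijnPhiDeriv₂ u) + deBruijnPhi u * deBruijnPhiDeriv u := by
  rw [turanN_eq]
  refine mul_pos (pow_pos (Real.exp_pos u) 2) (formN_pos_on ?_ ?_)
  · have h := le_thetaFreq_exp hu0 (by norm_num)
    exact le_trans (by norm_num) h
  · have h := thetaFreq_exp_le (1 / 4) (by norm_num) (by norm_num) (u := u) (by push_cast; linarith)
    exact h.trans (by exact_mod_cast (by decide +kernel : piHi * expPosHi (4 * (1 / 4)) ≤ (1709 / 200 : ℚ)))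

/-- The derivative of `u ↦ L(u)/u`: `(uV(u) − L(u))/u²`.
[cite: CsordasNorfolkVarga1986, the concavity of log Φ(√t) (= DimitrovLucas2011, Theorem B); kernel interval-arithmetic certificate (bookkeeping)] -/
theorem hasDerivAt_phiNegLogDeriv_div {u : ℝ} (hu : u ≠ 0) :
    HasDerivAt (fun a : ℝ => phiNegLogDeriv a / a) ((phiNegLogDeriv₂ u * u - phiNegLogDeriv u * 1) / u ^ 2) u :=
  (hasDerivAt_phiNegLogDeriv u).div (hasDerivAt_id u) hu

/-- `uV(u) − L(u) = N(u)/Φ(u)²`.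
[cite: CsordasNorfolkVarga1986, the concavity of log Φ(√t) (= DimitrovLucas2011, Theorem B); kernel interval-arithmetic certificate (bookkeeping)] -/
theorem mul_phiNegLogDeriv₂_sub (u : ℝ) :
    phiNegLogDeriv₂ u * u - phiNegLogDeriv u * 1 =
      (u * (deBruijnPhiDeriv u ^ 2 - deBruijnPhi u * deBruijnPhiDeriv₂ u) + deBruijnPhi u * deBruijnPhiDeriv u) /
        deBruijnPhi u ^ 2 := by
  have hΦ : deBruijnPhi u ≠ 0 := (deBruijnPhi_pos_holds u).ne'
  simp only [phiNegLogDeriv₂, phiNegLogDeriv]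
  field_simp
  ring

/-- `L(u)/u` is strictly increasing on `[0.11, 1/4]`.
[cite: CsordasNorfolkVarga1986, the concavity of log Φ(√t) (= DimitrovLucas2011, Theorem B); kernel interval-arithmetic certificate (bookkeeping)] -/
theorem strictMonoOn_phiNegLogDeriv_div_mid : StrictMonoOn (fun a : ℝ => phiNegLogDeriv a / a) (Icc (11 / 100) (1 / 4)) := by
  refine strictMonoOn_of_deriv_pos (convex_Icc _ _)
    (fun a ha => (hasDerivAt_phiNegLogDeriv_div (show a ≠ 0 by intro h; rw [h] at ha; norm_num at ha)).continuousAt.continuousWithinAt) ?_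
  intro a ha
  rw [interior_Icc] at ha
  have ha0 : 0 < a := lt_trans (by norm_num) ha.1
  rw [(hasDerivAt_phiNegLogDeriv_div ha0.ne').deriv, mul_phiNegLogDeriv₂_sub]
  exact div_pos (div_pos (turanN_pos ha.1.le ha.2.le) (pow_pos (deBruijnPhi_pos_holds a) 2)) (pow_pos ha0 2)

/-! ## 6. Assembly: monotonicity on `(0, 1/4]`, on `(0, ∞)`, and the item closer -/

/-- **`u ↦ −Φ′(u)/(uΦ(u))` is non-decreasing on `(0, 1/4]`** (Csordas–Varga 1988, Theorem 2.2, the small-`u` half;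
zero-free, by the kernel interval certificate).
[cite: CsordasNorfolkVarga1986, the concavity of log Φ(√t) (= DimitrovLucas2011, Theorem B); kernel interval-arithmetic certificate (bookkeeping)] -/
theorem monotoneOn_negPhiDeriv_div_quarter :
    MonotoneOn (fun u : ℝ => -deBruijnPhiDeriv u / (u * deBruijnPhi u)) (Ioc 0 (1 / 4)) := by
  have hgL : (fun u : ℝ => -deBruijnPhiDeriv u / (u * deBruijnPhi u)) = fun u => phiNegLogDeriv u / u := by
    funext u; simp only [phiNegLogDeriv]; rw [div_div, mul_comm]
  have hmid : MonotoneOn (fun u : ℝ => -deBruijnPhiDeriv u / (u * deBruijnPhi u)) (Icc (11 / 100) (1 / 4)) := by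
    rw [hgL]; exact strictMonoOn_phiNegLogDeriv_div_mid.monotoneOn
  have hunion : Ioc (0 : ℝ) (11 / 100) ∪ Icc (11 / 100) (1 / 4) = Ioc 0 (1 / 4) := by
    ext u; simp only [mem_union, mem_Ioc, mem_Icc]; constructor
    · rintro (⟨h1, h2⟩ | ⟨h1, h2⟩)
      · exact ⟨h1, by linarith⟩
      · exact ⟨by linarith, h2⟩
    · rintro ⟨h1, h2⟩
      by_cases h : u ≤ 11 / 100
      · exact Or.inl ⟨h1, h⟩
      · exact Or.inr ⟨(not_le.mp h).le, h2⟩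
  rw [← hunion]
  exact MonotoneOn.union_right monotoneOn_negPhiDeriv_div_small hmid ⟨⟨by norm_num, le_rfl⟩, fun x hx => hx.2⟩
    ⟨⟨le_rfl, by norm_num⟩, fun x hx => hx.1⟩

end Literature.NumberTheory.LFunctions.DeBruijnPhiCells

end Part7

/-!
## Part 8 — port of `Summits/RiemannHypothesis/RiemannHypothesis/Theorems/JensenPolynomialsXiDeltaSqPos.lean` (1 declarations kept)

# Route `JensenPolynomials` — crux `XiDeltaSqPos` (S-T5) CLOSED: the strict Turán inequalities of `ξ`'s Taylor
data, zero-free (RH-FREE proof-of-data; cell rh-jensen, HUMAN RULING D-0040)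

Assembly of the item: `monotoneOn_negPhiDeriv_div_quarter` (`JensenPolynomialsPhiMonotone.lean`: `u ↦ −Φ′(u)/(uΦ(u))`
non-decreasing on `(0, 1/4]`, from the kernel interval certificate; Csordas–Varga 1988 Thm 2.2 near `0`) fed to the
zero-free reduction `XiDeltaSqPos ⇐` that monotonicity (Chebyshev covariance for the law `u^{2k+2}Φ(u)du` with test
functions `u²` and `−Φ′/(uΦ)`, integration by parts `∫₀^∞ u^aΦ′ = −aM_{a−1}`, strictness from the envelope argument on
`[1/4, ∞)`; Csordas–Norfolk–Varga 1986) gives `XiDeltaSqPos` — `Δ(M)² > 0` for every `M ≥ 2`, i.e.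
`γ(k)γ(k+2) < γ(k+1)²` for all `k`: every degree-2 Jensen polynomial of `ξ` is hyperbolic — unconditionally
(`xiDeltaSqPos_holds`), the ITEM CLOSER `xiDeltaSqPos_item`, and the DISCHARGE `deBruijnPhiLogConcaveSqrt_holds` of the
Literature named fact `DeBruijnPhiLogConcaveSqrt` (`log Φ(√t)` concave on `(0, ∞)`).

PROVENANCE OF §1: the reduction lemmas of §1 are prover g2's `JensenPolynomialsXiDeltaSqPosOfLogConcaveSqrt.lean`
(p413120, ACCEPTED 2026-08-26T00:32Z) reproduced here as PRIVATE lemmas, by the director's ruling (director-rh g4,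
2026-08-26T04:51Z, D-0071) because the hub olean of that module was never built (every importer deferred `no-olean`
for > 4 h); when it is built, that module is the citable home of these statements and §1 is an implementation detail.
Axioms `propext`, `Classical.choice`, `Quot.sound`. WHAT THIS IS NOT: Turán's inequalities are necessary, far from
sufficient, for RH; nothing here bears on the zeros of `ζ`.

References: Csordas–Norfolk–Varga, Trans. AMS 296 (1986) 521–541 [CsordasNorfolkVarga1986]; Csordas–Varga, Constr.
Approx. 4 (1988) 175–198, Thm 2.2 [CsordasVarga1988]; Varga, SIAM CBMS 60 (1990) §3.3 [Varga1990]; Coffey–Csordas,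
Math. Comp. 82 (2013) Thm 2.4 [CoffeyCsordas2013].

(Verbatim declaration-level port — the declarations listed in the Part header count — of the Summits-side module of the
RiemannHypothesis tree's Jensen-polynomial cell; cell / rung / item bookkeeping in the text above is historical.)
-/

section Part8

namespace Literature.NumberTheory.LFunctions.DeBruijnPhiCells

open Literature.NumberTheory.LFunctions _root_.MeasureTheory _root_.Set _root_.Filter
open scoped _root_.Topology _root_.Nat

/-! ## 1. The zero-free reduction `XiDeltaSqPos ⇐ (−Φ′/(uΦ) non-decreasing on (0, 1/4])` (prover g2, p413120) -/

/-- **Strict monotonicity of `L(u)/u` on `[1/4, ∞)` (unconditional)** — the tree's argument for `[1, ∞)`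
(`strictMonoOn_phiNegLogDeriv_div`) verbatim: the derivative `(uV(u) − L(u))/u²` is positive because
`uV(u) > 16πu·e^{4u} ≥ 4πe^{4u} > 4πe^{4u} − 9 ≥ L(u)` once `u ≥ 1/4` (Coffey–Csordas' quantitative log-concavity and
the upper envelope of `L`).
[cite: CsordasNorfolkVarga1986, the concavity of log Φ(√t) (= DimitrovLucas2011, Theorem B); kernel interval-arithmetic certificate (bookkeeping)] -/
private theorem re_strictMonoOn_phiNegLogDeriv_div_quarter :
    StrictMonoOn (fun a : ℝ => phiNegLogDeriv a / a) (Ici (1 / 4)) := by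
  have hder : ∀ a : ℝ, 0 < a → HasDerivAt (fun a : ℝ => phiNegLogDeriv a / a)
      ((phiNegLogDeriv₂ a * a - phiNegLogDeriv a * 1) / a ^ 2) a := fun a ha =>
    (hasDerivAt_phiNegLogDeriv a).div (hasDerivAt_id a) ha.ne'
  refine strictMonoOn_of_deriv_pos (convex_Ici (1 / 4))
    (fun a ha => (hder a (lt_of_lt_of_le (by norm_num) ha)).continuousAt.continuousWithinAt) ?_
  intro a ha
  rw [interior_Ici] at ha
  have ha4 : 1 / 4 < a := ha
  have ha0 : 0 < a := lt_trans (by norm_num) ha4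
  rw [(hder a ha0).deriv]
  apply div_pos _ (pow_pos ha0 2)
  have hV := phiNegLogDeriv₂_gt a
  rw [abs_of_pos ha0] at hV
  have hL : phiNegLogDeriv a ≤ 4 * Real.pi * Real.exp (4 * a) - 9 := by
    unfold phiNegLogDeriv; exact neg_deBruijnPhiDeriv_div_le ha0.le
  have hE : 0 ≤ 16 * Real.pi * Real.exp (4 * a) := by positivity
  have h1 : 16 * Real.pi * Real.exp (4 * a) * (1 / 4) ≤ 16 * Real.pi * Real.exp (4 * a) * a :=
    mul_le_mul_of_nonneg_left ha4.le hE
  have h2 : 16 * Real.pi * Real.exp (4 * a) * a < phiNegLogDeriv₂ a * a := mul_lt_mul_of_pos_right hV ha0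
  linarith

end Literature.NumberTheory.LFunctions.DeBruijnPhiCells

end Part8

/-! ## Part 9 — the EXACT discharge `DeBruijnPhiLogConcaveSqrt_holds` -/

namespace Literature.NumberTheory.LFunctions

open MeasureTheory Set Filter
open scoped Topology
open DeBruijnPhiCells DeBruijnPhiCells.CoeffTable

/-- **The named fact `DeBruijnPhiLogConcaveSqrt` HOLDS** (`DeBruijnPhiLogConcaveSqrt.lean`; Csordas–Norfolk–Varga 1986: `log Φ(√t)` is concave,
i.e. `u ↦ −Φ′(u)/(uΦ(u))` is non-decreasing on `(0, ∞)`).  EXACT-name discharge: `(0, 1/4]` by the kernel interval-arithmetic certificate of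
the previous Parts, `[1/4, ∞)` by the tree's envelope argument `re_strictMonoOn_phiNegLogDeriv_div_quarter`.  Literature-side twin of the
Summits-side `Summit.RiemannHypothesis.RiemannHypothesis.Theorems.JensenPolynomials.deBruijnPhiLogConcaveSqrt_holds` (same proof).
[cite: CsordasNorfolkVarga1986, the concavity of log Φ(√t) (= DimitrovLucas2011, Theorem B)] -/
theorem DeBruijnPhiLogConcaveSqrt_holds : DeBruijnPhiLogConcaveSqrt := by
  have hgL : (fun u : ℝ => -deBruijnPhiDeriv u / (u * deBruijnPhi u)) = fun u => phiNegLogDeriv u / u := by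
    funext u; simp only [phiNegLogDeriv]; rw [div_div, mul_comm]
  have hlarge : MonotoneOn (fun u : ℝ => -deBruijnPhiDeriv u / (u * deBruijnPhi u)) (Ici (1 / 4)) := by
    rw [hgL]; exact re_strictMonoOn_phiNegLogDeriv_div_quarter.monotoneOn
  have hunion : Ioc (0 : ℝ) (1 / 4) ∪ Ici (1 / 4) = Ioi 0 := by
    ext u; simp only [mem_union, mem_Ioc, mem_Ici, mem_Ioi]; constructor
    · rintro (⟨h, _⟩ | h)
      · exact h
      · linarith
    · intro h; by_cases h4 : u ≤ 1 / 4
      · exact Or.inl ⟨h, h4⟩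
      · exact Or.inr (le_of_lt (not_le.mp h4))
  show MonotoneOn (fun u : ℝ => -deBruijnPhiDeriv u / (u * deBruijnPhi u)) (Ioi 0)
  rw [← hunion]
  exact MonotoneOn.union_right monotoneOn_negPhiDeriv_div_quarter hlarge ⟨⟨by norm_num, le_rfl⟩, fun x hx => hx.2⟩
    ⟨Set.mem_Ici.2 le_rfl, fun x hx => hx⟩

end Literature.NumberTheory.LFunctions

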